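import Literature.MathematicalPhysics.QuantumFieldTheory.Balaban1983to89.Node00.Record13DatumKeyCoP
import Literature.MathematicalPhysics.QuantumFieldTheory.Balaban1983to89.Node00.Record13CoPR

/-!
# NODE 00 (YM-PLAN Track A) — THE STAGE-13 DATUM ∕ RECORD KEYS OF THE v1.6 `CoPR` EDITION: `IsDatumOfRecord₁₃CCoPR` (+ `.params ∕ .provisos`, `canon₁₃CoPR`,
# `IsRateKey₁₃CoPR`), the regime keys `IsDatumOfRecord₁₃CCoPROn ∕ IsRecordOfRecord₁₃CCoPROn ∕ canon₁₃CoPROn`, the CN keys `IsDatumOfRecord₁₃CCoPRN ∕ IsRecordOfRecord₁₃CCoPRN`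
# at the RE-ISSUED guard of record `unityNondeg₁₃R N F θ := θ.ZrUnity F N ∧ θ.SlotsNondegenerate₁₃ F N` over def-T's RUN-INDEXED parameter structure `Stage13RParams`
# (`Node00/Record13CoPR`, FILE 25, FINDING №8 ∕ director-ym №169 H1 ∕ №174), keyed FLAT on `datumOfRecord₁₃CoPR F N θ (h : θ.Provisos₁₃CoPR F N)`; §8: the ONE-WAY run-blind
# doors `…CoP → …CoPR` along def-T's `Stage13RParams.ofRunBlind`

NODE 00 RECORD MODULE (cell `pub-ymgap`, seat `pub-ymgap-node00-def-RR-2` gen 12 = second reader ∕ key + instance side of the RATE-RECORD HOME, director-ym R141 (A);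
dag-lead «datum-KEY twin leaf = RR-2 lineage, one declarer»).  THE `CoPR` TWIN (v1.6 EDITION) of this seat's `Node00/Record13DatumKeyCoP` (p521571; the v1.5 `CoP` keys over
`Stage13Params.Provisos₁₃Core` and `datumOfRecord₁₃CoP`).  THE v1.6 EDITION, SAID ONCE (def-T `KEYMAP-Record13-v1.6.md`, KEY-RULE-25): the residual 𝐓-weight of RECORD 13 is
RUN-INDEXED — def-T's `structure Stage13RParams F N extends Stage13Params F N` carries ONE new field `Zr : (p : B12.RunParams) → TkResidualW F N (FluctV N) p.K` (print's
`ζ(Ω^c_{k+1})` reads the run: [III] (1.11) p.248, (2.4) p.255, p.267), the weights of record are `WtOfRecord₁₃R` (`θ.Zr p` where v1.5 read the run-blind `θ.Zt p.K`), the bg-free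
proviso core is `Stage13RParams.Provisos₁₃CoPR` (v1.2's `Provisos₁₃Core` rows VERBATIM at `θ.toStage13Params` + `zrLaws ∕ zrLocal`), the guard is `Stage13RParams.ZrUnity`, and the
§2 form, the 𝐑-leaf, the Stage-5 residual `Stage13RParams.toStage5₁₃CoPR`, the core, the tower and the datum `datumOfRecord₁₃CoPR` are def-T's FILE 23 family re-generated name
for name (`CoP ↦ CoPR`); every θ-level object of v1.2 that does not read the residual slot (`gOfRecord₁₃`, `betaOfRecord₁₃`, `EOfRecord₁₃`, `UbgOfRecord₁₃CoP`, `Stage13Params.Admissible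
∕ .SlotsNondegenerate₁₃`, the residual-assignment types `RateAssignment₁₃ ∕ SpineAssignment₁₃` and their lifts, …) is NOT re-issued and is CITED at `θ.toStage13Params`
(KEY-RULE-25 SITE-RULE; through `extends`, `θ.Admissible F N`, `θ.SlotsNondegenerate₁₃ F N`, `θ.γ`, `θ.L` read the parent structure).  This module is that token map applied
to `Node00/Record13DatumKeyCoP`: EVERY declaration of §1–§7 below is the v1.5-keyed declaration with binder `(θ : Stage13Params F N) ↦ (θ : Stage13RParams F N)` (also inside the
regimes' type `Rg : (F : T4Family) → Stage13RParams F N → Prop` and the canonical readings' value types), `(h : θ.Provisos₁₃Core F N) ↦ (h : θ.Provisos₁₃CoPR F N)`,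
`datumOfRecord₁₃CoP ↦ datumOfRecord₁₃CoPR`, `θ.toStage5₁₃CoP ↦ θ.toStage5₁₃CoPR`, `IsRecordOfRecord₁₃CCoP… ↦ IsRecordOfRecord₁₃CCoPR…`, `θ.ZtUnity ↦ θ.ZrUnity`,
`unityNondeg₁₃ ↦ unityNondeg₁₃R` in statement and proof, under the NAME RULE «def-T's token `CoPR` at def-T's position»: `IsDatumOfRecord₁₃CCoP[On∕N] ↦ IsDatumOfRecord₁₃CCoPR[On∕N]`,
`IsRecordOfRecord₁₃CCoP(On∕N) ↦ IsRecordOfRecord₁₃CCoPR(On∕N)`, `canon₁₃CoP[On] ↦ canon₁₃CoPR[On]`, `IsRateKey₁₃CoP ↦ IsRateKey₁₃CoPR`, the theorem stems likewise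
(`isDatumOfRecord₁₃CCoPR_datumOfRecord₁₃CoPR`, `exists_keyed_canon₁₃CoPR_iff`, `keyed_canon₁₃CoPROn_coherent`, `forall_isRecordOfRecord₁₃CCoPRN_iff`, …; ONE face renamed with its
content: `IsDatumOfRecord₁₃CCoPN.ztUnity ↦ IsDatumOfRecord₁₃CCoPRN.zrUnity`), and the SITE-RULE at the four θ-level read-off faces (`….βfun_eq_betaOfRecord₁₃ : D.βfun = betaOfRecord₁₃ F N
h.params.toStage13Params`, `….flow_g : (D.C p).flow.g = gOfRecord₁₃ F N h.params.toStage13Params p`, plain and `On`) — the 106 declarations of the v1.5 leaf map onto the 106 of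
§1–§7 ONE FOR ONE, statement AND proof (checked byte for byte against the landed file before filing, and decl by decl against dag-n22-e's independently generated image).  TWO
declarations are NEW in §7: the guard of record RE-ISSUED over the run-indexed structure, `unityNondeg₁₃R N : (F : T4Family) → Stage13RParams F N → Prop := fun F θ => θ.ZrUnity F N
∧ θ.SlotsNondegenerate₁₃ F N` with `unityNondeg₁₃R_iff` (`Iff.rfl`) — the v1.2 guard `unityNondeg₁₃` of `Node00/Record13DatumKey` is typed over `Stage13Params` and bundles the
run-blind `ZtUnity`, so it cannot be cited at a `Stage13RParams` (def-T Q1: the K0⁶ guard is `θ.ZrUnity F 2 ∧ θ.SlotsNondegenerate₁₃ F 2`; name agreed with the first consumer,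
dag-n22-e).  KEYED FLAT on `datumOfRecord₁₃CoPR`.  APPEND-ONLY: a NEW leaf importing this seat's `Node00/Record13DatumKeyCoP` (the v1.5 classes, for §8; transitively
`Node00/Record13DatumKey`'s θ-level assignments by name) and def-T's `Node00/Record13CoPR`; NOTHING landed is edited — the ‴, ⁗, `SepMixed`, `Co`, `SepCo`, `CoP`, `SepCoP` key
modules stand VERBATIM (keys of the earlier editions; their landed storeys are settled helper leaves).

CONSUMED BY NAME from def-T's `Node00/Record13CoPR`: `Stage13RParams`, `Stage13RParams.ZrUnity`, `Stage13RParams.Provisos₁₃CoPR`, `datumOfRecord₁₃CoPR`,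
`Stage13RParams.toStage5₁₃CoPR`, the RECORD PREDICATE `IsRecordOfRecord₁₃CCoPR F N D w` := `∃ θ (h : θ.Provisos₁₃CoPR F N), θ.Admissible F N ∧ D = datumOfRecord₁₃CoPR F N θ h ∧
w.C = D.C ∧ (0 < w.γ ∧ w.γ ≤ θ.γ) ∧ w.L = θ.L ∧ ∀ P, w.up P = upOfRecord₅C F N (θ.toStage5₁₃CoPR F N) P` (clause order identical to every earlier edition),
`exists_world_isRecordOfRecord₁₃CCoPR`, `exists_provisos_of_isRecordOfRecord₁₃CCoPR`, `exists_isRecordOfRecord₅C_of_isRecordOfRecord₁₃CCoPR`, the `rfl` ∕ read-off faces `βfun_ ∕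
flow_g_ ∕ av_ ∕ isDatumOfRecord₀_datumOfRecord₁₃CoPR`, `isPrintedAveraged_datumOfRecord₁₃CoPR`, and — for §8 only — the RUN-BLIND EMBEDDING `Stage13RParams.ofRunBlind θ := ⟨θ, fun p
=> θ.Zt p.K⟩` with `Stage13Params.Provisos₁₃Core.ofRunBlind`, `Stage12Params.ZtUnity.ofRunBlind`, `Stage13RParams.admissible_ofRunBlind_iff ∕ slotsNondegenerate₁₃_ofRunBlind_iff`
(`Iff.rfl`), `datumOfRecord₁₃CoPR_ofRunBlind` and `Stage13RParams.toStage5₁₃CoPR_ofRunBlind` (`rfl`).  The key layer is PROVISO-FIELD-BLIND, BACKGROUND-BLIND and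
RESIDUAL-SLOT-BLIND (no declaration here projects a field of `Provisos₁₃CoPR`, reads `UbgOfRecord₁₃CoP` or reads `θ.Zr`), which is why the re-key is a token map and every
proof term of §1–§7 is the v1.5 proof term.

WHY THIS OBJECT (as at v1.1–v1.5; said once more for the v1.6 reader).  The rate-record home and the spine-record home of clusters K4 ∕ K5 are read JOINTLY by the N19′
edge, so both are keyed to ONE parameter per datum: THE CANONICAL PARAMETER `h.params := Classical.choose h` of `h : IsDatumOfRecord₁₃CCoPR F N D`, with `h.provisos :
h.params.Provisos₁₃CoPR F N`, `h.admissible`, `h.eq_datumOfRecord₁₃CoPR : D = datumOfRecord₁₃CoPR F N h.params h.provisos`; every θ-level object of record then has ONE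
datum-level instance per `(F, D, g₀, os)`, keyed records are COHERENT (`exists_keyed_canon₁₃CoPR_iff`, `keyed_canon₁₃CoPR_coherent`), and a consumer proving its node at EVERY
admissible run-indexed tuple with core provisos proves it at the datum (`IsDatumOfRecord₁₃CCoPR.forall_params`).  `isDatumOfRecord₁₃CCoPR_iff_exists_world`: the datum class IS
def-T's `IsRecordOfRecord₁₃CCoPR` with the world forgotten; «`∃ D w, IsRecordOfRecord₁₃CCoPR F N D w`» REDUCES HONESTLY to «one admissible `Stage13RParams` with every field of
`Provisos₁₃CoPR` a theorem» (`exists_isDatumOfRecord₁₃CCoPR_iff_exists_params`) — INHABITATION IS NOT CLAIMED HERE.  THE REGIME KEYS (§4–§6) and the CN KEYS (§7) read exactly as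
at v1.5 with `Rg : (F : T4Family) → Stage13RParams F N → Prop` and the guard `unityNondeg₁₃R N` (literal faces `isDatumOfRecord₁₃CCoPRN_iff`, `exists_isDatumOfRecord₁₃CCoPRN_iff_exists_params`,
`forall_isRecordOfRecord₁₃CCoPRN_iff` = a CoPR-keyed ∀-storey's binder prefix `∀ (θ : Stage13RParams F N) (hc : θ.Provisos₁₃CoPR F N), (θ.ZrUnity F N ∧ θ.SlotsNondegenerate₁₃ F N) →
θ.Admissible F N → … (datumOfRecord₁₃CoPR F N θ hc) …`).  The route's ITEM texts of the v1.6 revision key on the proviso OF RECORD `Stage13RParams.Provisos₁₃SepCoPR` (the item must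
SEE the `bg` row; def-T FILE 26T `Node00/Record13SepCoPR`); the item-facing junction sentences live in this seat's `Node00/Record13DatumKeySepCoPR`, whose §8 bridges the
`SepCoPR`-keyed classes INTO the classes below along `Provisos₁₃SepCoPR.toCore` (datum by `rfl`), exactly as `…KeySepCoP` §8 does at v1.5.

§8 — THE RUN-BLIND DOORS (NEW; ONE-WAY).  Along def-T's embedding `Stage13RParams.ofRunBlind` every v1.5 `CoP`-keyed fact IS a v1.6 `CoPR`-keyed fact AT THE SAME DATUM AND WORLD:
`IsDatumOfRecord₁₃CCoPR.ofCoP : IsDatumOfRecord₁₃CCoP F N D → IsDatumOfRecord₁₃CCoPR F N D`, `IsRateKey₁₃CoPR.ofCoP : IsRateKey₁₃CoP F N D w θ → IsRateKey₁₃CoPR F N D w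
(Stage13RParams.ofRunBlind F N θ)`, the regime forms `IsDatumOfRecord₁₃CCoPROn.ofCoP ∕ IsRecordOfRecord₁₃CCoPROn.ofCoP` (given a regime transport `∀ F θ, Rg F θ → RgR F
(Stage13RParams.ofRunBlind F N θ)`), and the CN instances `IsDatumOfRecord₁₃CCoPRN.ofCoP ∕ IsRecordOfRecord₁₃CCoPRN.ofCoP` (the guard transported by `Stage12Params.ZtUnity.ofRunBlind` and
`Iff.rfl`) — the datum-level half of «K0 of the v1.6 revision ⇐ K0 of v1.5» (def-T's record-level `IsRecordOfRecord₁₃CCoPR.ofCoP` is the other half).  NO CONVERSE exists or is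
claimed: a run-indexed residual is in general NOT constant along the runs on one torus (that is FINDING №8), so nothing `CoPR → CoP` is filed; and, as at every edition, NO bridge
from or to the ‴ ∕ ⁗ ∕ `SepMixed` ∕ `Co` ∕ `SepCo` keys is statable (different data of record).

WHAT IS NOT HERE.  NO edit of any landed key module or consumer; NO `CoPR → CoP`, NO `CoPR → SepCoPR` bridge; NO `₁₂ ↔ ₁₃` key bridge; NO reading of any proviso row, of the
background or of the residual slot `Zr`; NO inhabitant of any key; the θ-level assignments are NOT re-declared (imported by name and cited at `θ.toStage13Params` by the
consumers); def-T's run-indexed record predicate and its faces are NOT re-declared (consumed by name from `Node00/Record13CoPR`); NO `Provisos₁₃CoPR` inhabitant and NO record is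
claimed to exist.

HONEST FRAMING.  Definitions of record + kernel bookkeeping (`Classical.choose`, `rfl`, `dite`, ∃-repackaging) — a typing-faithfulness re-key (FINDING №8) of a CONDITIONAL
finite-𝕋⁴ record at fixed `ε`; NOTHING of Bałaban's is asserted; NO inhabitant of any key is claimed (the record's inhabitation item is OPEN); no node is discharged; counts
unmoved (COUNT-NEUTRAL); one finite four-torus programme at fixed `ε` — NOT the continuum limit on ℝ⁴, NOT infinite volume, NOT OS, NOT a mass gap, NOT the Clay problem.
No `sorry` ∕ `axiom` ∕ `opaque` ∕ `instance` ∕ `notation`.  [Balaban1989LargeFieldII] = Commun. Math. Phys. **122** (1989) 355–392; [III] = [Balaban1988Convergent] = Commun.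
Math. Phys. **119** (1988) 243–285 ((1.11) p.248, (2.4) p.255, p.267: the residual reads the run; (3.16)–(3.22) pp.268–269: the partition of unity); [Balaban1988RG2Cluster] =
Commun. Math. Phys. **116** (1988) 1–22; [Balaban1987RG1] = Commun. Math. Phys. **109** (1987) 249–301; [15] = [Balaban1985Variational] = Commun. Math. Phys. **102** (1985)
277–309 and [6] = [Balaban1985RegularSpaces] = Commun. Math. Phys. **99** (1985) 75–102 cited for orientation only, nothing of them asserted.
-/

noncomputable section

namespace Literature.MathematicalPhysics.QuantumFieldTheory.Balaban1983to89.Node00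

open T4Continuum AveragingRT T4FiniteEpsInhabited FlowStep FlowStepRuns DagBinding T4DatumAssembly

/-! ## §1. «`D` is a datum of record, Stage 13» and its CANONICAL parameter -/

section DatumKey

variable (F : T4Family) (N : ℕ) [NeZero N]

/-- **«`D` is a datum of record, Stage 13 (C-class)»**: SOME admissible Stage-13 parameter tuple satisfying its displayed provisos has `D` as its datum of record — the
datum-level shadow of `IsRecordOfRecord₁₃CCoPR` (the world forgotten; `isDatumOfRecord₁₃CCoPR_iff_exists_world`). [cite: Balaban1989LargeFieldII, Thm 1 + (0.1) pp.355–356; Balaban1988Convergent, Thms 1–2 pp.262–263 (objects of record; bookkeeping)] -/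
def IsDatumOfRecord₁₃CCoPR (D : FiniteEpsData F (SU N)) : Prop :=
  ∃ (θ : Stage13RParams F N) (h : θ.Provisos₁₃CoPR F N), θ.Admissible F N ∧ D = datumOfRecord₁₃CoPR F N θ h

/-- Every admissible Stage-13 parameter tuple with provisos yields a datum of record. [cite: Balaban1989LargeFieldII, Thm 1 + (0.1) pp.355–356 (bookkeeping)] -/
theorem isDatumOfRecord₁₃CCoPR_datumOfRecord₁₃CoPR (θ : Stage13RParams F N) (h : θ.Provisos₁₃CoPR F N) (hθ : θ.Admissible F N) :
    IsDatumOfRecord₁₃CCoPR F N (datumOfRecord₁₃CoPR F N θ h) :=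
  ⟨θ, h, hθ, rfl⟩

/-- **K0′ READS THE SAME AT THE DATUM**: some datum of record exists at `(F, N)` iff some Stage-13 record pair `(D, w)` exists (the body of the route's K0′
`Record12Inhabited` at `N`). [cite: Balaban1989LargeFieldII, Thm 1 + (0.1) pp.355–356 (bookkeeping)] -/
theorem exists_isDatumOfRecord₁₃CCoPR_iff_exists_record :
    (∃ D : FiniteEpsData F (SU N), IsDatumOfRecord₁₃CCoPR F N D) ↔ ∃ (D : FiniteEpsData F (SU N)) (w : WorldP), IsRecordOfRecord₁₃CCoPR F N D w := by
  constructor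
  · rintro ⟨_, θ, hP, hθ, rfl⟩
    obtain ⟨w, hw, -⟩ := exists_world_isRecordOfRecord₁₃CCoPR F N θ hP hθ ⟨hθ.toStage9.gamma_pos, le_rfl⟩
    exact ⟨_, w, hw⟩
  · rintro ⟨D, w, hw⟩
    exact ⟨D, exists_provisos_of_isRecordOfRecord₁₃CCoPR hw⟩

/-- **THE HONEST REDUCTION OF K0′**: some datum of record exists at `(F, N)` iff SOME Stage-13 parameter tuple is admissible and satisfies every displayed proviso —
«exhibit ONE admissible `Stage13RParams` with EVERY proviso field a theorem» (the K0′ components); inhabitation is NOT claimed in this module.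
[cite: Balaban1988Convergent, (2.7) p.255, (2.21) p.258, (2.28) p.259, (3.16) p.268, (3.21) p.269; Balaban1987RG1, (1.12)–(1.15) p.262 (hypothesis dictionary; bookkeeping)] -/
theorem exists_isDatumOfRecord₁₃CCoPR_iff_exists_params :
    (∃ D : FiniteEpsData F (SU N), IsDatumOfRecord₁₃CCoPR F N D) ↔ ∃ θ : Stage13RParams F N, θ.Provisos₁₃CoPR F N ∧ θ.Admissible F N := by
  constructor
  · rintro ⟨_, θ, hP, hθ, -⟩
    exact ⟨θ, hP, hθ⟩
  · rintro ⟨θ, hP, hθ⟩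
    exact ⟨_, isDatumOfRecord₁₃CCoPR_datumOfRecord₁₃CoPR F N θ hP hθ⟩

variable {F N}
variable {D : FiniteEpsData F (SU N)} {w : WorldP}

/-- A Stage-13 record's datum is a Stage-13 datum of record. [cite: Balaban1989LargeFieldII, Thm 1 p.355 (bookkeeping)] -/
theorem isDatumOfRecord₁₃CCoPR_of_isRecordOfRecord₁₃CCoPR (h : IsRecordOfRecord₁₃CCoPR F N D w) : IsDatumOfRecord₁₃CCoPR F N D :=
  exists_provisos_of_isRecordOfRecord₁₃CCoPR h

/-- **DATUM OF RECORD ⟺ RECORD AT SOME WORLD.** [cite: Balaban1989LargeFieldII, Thm 1 + (0.1) pp.355–356 (bookkeeping)] -/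
theorem isDatumOfRecord₁₃CCoPR_iff_exists_world : IsDatumOfRecord₁₃CCoPR F N D ↔ ∃ w : WorldP, IsRecordOfRecord₁₃CCoPR F N D w := by
  constructor
  · rintro ⟨θ, hP, hθ, rfl⟩
    obtain ⟨w, hw, -⟩ := exists_world_isRecordOfRecord₁₃CCoPR F N θ hP hθ ⟨hθ.toStage9.gamma_pos, le_rfl⟩
    exact ⟨w, hw⟩
  · rintro ⟨w, hw⟩
    exact isDatumOfRecord₁₃CCoPR_of_isRecordOfRecord₁₃CCoPR hw

/-- **THE CANONICAL STAGE-13 PARAMETER OF A DATUM OF RECORD** (choice) — the ONE key both carrier records of clusters K4 ∕ K5 are read at.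
[cite: Balaban1989LargeFieldII, Thm 1 + (0.1) pp.355–356 (bookkeeping)] -/
def IsDatumOfRecord₁₃CCoPR.params (h : IsDatumOfRecord₁₃CCoPR F N D) : Stage13RParams F N :=
  Classical.choose h

/-- Its provisos. [cite: Balaban1988Convergent, (2.7) p.255, (2.21) p.258, (2.35) p.261 (bookkeeping)] -/
theorem IsDatumOfRecord₁₃CCoPR.provisos (h : IsDatumOfRecord₁₃CCoPR F N D) : h.params.Provisos₁₃CoPR F N :=
  (Classical.choose_spec h).fst

/-- Its admissibility. [cite: Balaban1987RG1, (1.12) p.262; Balaban1988Convergent, (2.10) p.256 (bookkeeping)] -/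
theorem IsDatumOfRecord₁₃CCoPR.admissible (h : IsDatumOfRecord₁₃CCoPR F N D) : h.params.Admissible F N :=
  (Classical.choose_spec h).snd.1

/-- **The datum IS the datum of record of its canonical parameter.** [cite: Balaban1989LargeFieldII, Thm 1 p.355 (bookkeeping)] -/
theorem IsDatumOfRecord₁₃CCoPR.eq_datumOfRecord₁₃CoPR (h : IsDatumOfRecord₁₃CCoPR F N D) : D = datumOfRecord₁₃CoPR F N h.params h.provisos :=
  (Classical.choose_spec h).snd.2

/-- The canonical parameter's coupling window is positive. [cite: Balaban1987RG1, (0.21) p.256 (bookkeeping)] -/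
theorem IsDatumOfRecord₁₃CCoPR.gamma_pos (h : IsDatumOfRecord₁₃CCoPR F N D) : 0 < h.params.γ :=
  h.admissible.toStage9.gamma_pos

/-- … and lies inside `]0, 1[` (the Stage-12 sign `γ < 1` of the tuple's Stage-12 admissibility). [cite: Balaban1988Convergent, (2.28) p.259 (bookkeeping)] -/
theorem IsDatumOfRecord₁₃CCoPR.gamma_lt_one (h : IsDatumOfRecord₁₃CCoPR F N D) : h.params.γ < 1 :=
  h.admissible.toStage12.pos₁₂.2.2.2.2

/-- **WHAT A CONSUMER PROVES ⟹ WHAT THE INSTANCE CARRIES**: a property of the objects of record established at EVERY admissible Stage-13 parameter tuple with provisos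
holds at the canonical parameter of every datum of record. [cite: Balaban1989LargeFieldII, Thm 1 p.355 (bookkeeping)] -/
theorem IsDatumOfRecord₁₃CCoPR.forall_params {P : (D : FiniteEpsData F (SU N)) → (θ : Stage13RParams F N) → θ.Provisos₁₃CoPR F N → Prop}
    (hP : ∀ (θ : Stage13RParams F N) (hθ : θ.Provisos₁₃CoPR F N), θ.Admissible F N → P (datumOfRecord₁₃CoPR F N θ hθ) θ hθ) (h : IsDatumOfRecord₁₃CCoPR F N D) :
    P D h.params h.provisos := by
  have := hP h.params h.provisos h.admissible
  rwa [← h.eq_datumOfRecord₁₃CoPR] at this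

/-- **WORLD COMPANION IN `₁₃C` AT ANY WINDOW BELOW THE CANONICAL ONE**: for `0 < γw ≤ h.params.γ` some world makes `(D, w)` a Stage-13 record with `w.γ = γw` — what
the N17 home-keying binder («`RRec … R → ∃ w, IsRecordOfRecord₁₃CCoPR F N D w ∧ R.u3.γ = w.γ`») consumes once `R.u3.γ` is pinned in that range.
[cite: Balaban1989LargeFieldII, Thm 1 + (0.1) pp.355–356 (bookkeeping)] -/
theorem IsDatumOfRecord₁₃CCoPR.exists_world (h : IsDatumOfRecord₁₃CCoPR F N D) {γw : ℝ} (hγw : 0 < γw ∧ γw ≤ h.params.γ) :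
    ∃ w : WorldP, IsRecordOfRecord₁₃CCoPR F N D w ∧ w.γ = γw := by
  obtain ⟨w, hw, hγ⟩ := exists_world_isRecordOfRecord₁₃CCoPR F N h.params h.provisos h.admissible hγw
  exact ⟨w, h.eq_datumOfRecord₁₃CoPR ▸ hw, hγ⟩

/-- … in particular at the canonical window `h.params.γ` itself. [cite: Balaban1989LargeFieldII, Thm 1 + (0.1) pp.355–356 (bookkeeping)] -/
theorem IsDatumOfRecord₁₃CCoPR.exists_world_gamma (h : IsDatumOfRecord₁₃CCoPR F N D) :
    ∃ w : WorldP, IsRecordOfRecord₁₃CCoPR F N D w ∧ w.γ = h.params.γ :=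
  h.exists_world ⟨h.gamma_pos, le_rfl⟩

/-- **THE DATUM's β-FUNCTIONS ARE THE STAGE-13 β OF RECORD AT THE CANONICAL PARAMETER** (def-T's `βfun_datumOfRecord₁₃CoPR`, `rfl` there; `betaOfRecord₁₃ F N θ` over
`Stage13RParams` is def-T's reducible name for the β of record re-based on the canonical-version transport and the (2.9)-species small-field function — NOT `betaOfRecord₁₀` of Stages 10–12: the histories of record differ, and there is
NO ₁₂ ↔ ₁₃ key bridge in this module) — what the (D4) read-out binders and node N17 read off `D`.
[cite: Balaban1987RG1, (1.20)–(1.22) p.264 (bookkeeping)] -/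
theorem IsDatumOfRecord₁₃CCoPR.βfun_eq_betaOfRecord₁₃ (h : IsDatumOfRecord₁₃CCoPR F N D) : D.βfun = betaOfRecord₁₃ F N h.params.toStage13Params := by
  have := βfun_datumOfRecord₁₃CoPR F N h.params h.provisos
  rwa [← h.eq_datumOfRecord₁₃CoPR] at this

/-- The datum's coupling flow of the run `p` IS the Stage-13 generated history of record of the canonical parameter (def-T's `flow_g_datumOfRecord₁₃CoPR`).
[cite: Balaban1987RG1, (0.17)–(0.20) pp.255–256 (bookkeeping)] -/
theorem IsDatumOfRecord₁₃CCoPR.flow_g (h : IsDatumOfRecord₁₃CCoPR F N D) (p : B12.RunParams) :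
    (D.C p).flow.g = gOfRecord₁₃ F N h.params.toStage13Params p := by
  have := flow_g_datumOfRecord₁₃CoPR F N h.params h.provisos p
  rwa [← h.eq_datumOfRecord₁₃CoPR] at this

/-- The datum's averaging maps ARE the averaging maps of record. [cite: Balaban1987RG1, (0.4) p.253 (bookkeeping)] -/
theorem IsDatumOfRecord₁₃CCoPR.av_eq (h : IsDatumOfRecord₁₃CCoPR F N D) : D.av = avOfRecord F N := by
  have := av_datumOfRecord₁₃CoPR F N h.params h.provisos
  rwa [← h.eq_datumOfRecord₁₃CoPR] at this

/-- A Stage-13 datum of record is a datum of record, Stage 0 (binder B1 ∕ node N23's reading). [cite: Balaban1987RG1, (0.3)–(0.4) p.253 (bookkeeping)] -/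
theorem IsDatumOfRecord₁₃CCoPR.isDatumOfRecord₀ (h : IsDatumOfRecord₁₃CCoPR F N D) : IsDatumOfRecord₀ F N D := by
  rw [h.eq_datumOfRecord₁₃CoPR]
  exact isDatumOfRecord₀_datumOfRecord₁₃CoPR F N h.params h.provisos

/-- N23 · binder B1 at every Stage-13 datum of record. [cite: Balaban1987RG1, (0.4) p.253] -/
theorem IsDatumOfRecord₁₃CCoPR.isPrintedAveraged (h : IsDatumOfRecord₁₃CCoPR F N D) : D.IsPrintedAveraged := by
  rw [h.eq_datumOfRecord₁₃CoPR]
  exact isPrintedAveraged_datumOfRecord₁₃CoPR F N h.params h.provisos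

/-- **THE ₅C SHADOW AT THE CANONICAL PARAMETER**: a Stage-13 datum of record is refined by a Stage-5 C-bound record at some world (def-T's
`exists_isRecordOfRecord₅C_of_isRecordOfRecord₁₃CCoPR` through the world companion) — for consumers keyed at ₅C. [cite: Balaban1989LargeFieldII, Thm 1 + (0.1) pp.355–356 (bookkeeping)] -/
theorem IsDatumOfRecord₁₃CCoPR.exists_isRecordOfRecord₅C (h : IsDatumOfRecord₁₃CCoPR F N D) :
    ∃ (D₅ : FiniteEpsData F (SU N)) (w : WorldP), IsRecordOfRecord₅C F N D₅ w ∧ D₅.C = D.C ∧ (∀ K g₀ k, D₅.dens K g₀ k = D.dens K g₀ k) ∧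
      D₅.βfun = D.βfun ∧ D₅.av = D.av := by
  obtain ⟨w, hw, -⟩ := h.exists_world_gamma
  obtain ⟨D₅, h₅⟩ := exists_isRecordOfRecord₅C_of_isRecordOfRecord₁₃CCoPR hw
  exact ⟨D₅, w, h₅⟩

end DatumKey

/-! ## §2. Canonicalised readings — COHERENCE for records keyed «`∃ θ hP, θ.Admissible F N ∧ D = datumOfRecord₁₃CoPR F N θ hP ∧ S = cr F θ hP …`»

Reading an existentially keyed record through `canon₁₃CoPR f` makes the admitted bundle a function of the DATUM: `canon₁₃CoPR f θ hP = f h.params h.provisos` whenever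
`datumOfRecord₁₃CoPR F N θ hP = D` and `h : IsDatumOfRecord₁₃CCoPR F N D` (`canon₁₃CoPR_eq_of_eq`), so two records keyed independently but read through `canon₁₃CoPR` admit, at the
same `(F, D, g₀, os)`, bundles read at the SAME parameter (`exists_keyed_canon₁₃CoPR_iff` turns either key into «`∃ h : IsDatumOfRecord₁₃CCoPR F N D, Φ (f h.params
h.provisos)`»).  Off the datum-of-record class `canon₁₃CoPR f = f`. -/
section Canon

variable (F : T4Family) (N : ℕ) [NeZero N] {α : Sort*}

/-- **CANONICALISED READING**: read `f` at the canonical parameter of the datum `datumOfRecord₁₃CoPR F N θ hP` when that datum is of record (admissible), else at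
`(θ, hP)` itself.  Kernel bookkeeping (`Classical.dec`, `dite`). [cite: Balaban1989LargeFieldII, Thm 1 + (0.1) pp.355–356 (bookkeeping)] -/
def canon₁₃CoPR (f : (θ : Stage13RParams F N) → θ.Provisos₁₃CoPR F N → α) (θ : Stage13RParams F N) (hP : θ.Provisos₁₃CoPR F N) : α := by
  classical
  exact if h : IsDatumOfRecord₁₃CCoPR F N (datumOfRecord₁₃CoPR F N θ hP) then f h.params h.provisos else f θ hP

variable {F N}

/-- The canonical parameter depends on the datum only: transport of the key along `D = D'` does not change `.params` (proof irrelevance + `subst`).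
[cite: Balaban1989LargeFieldII, Thm 1 + (0.1) pp.355–356 (bookkeeping)] -/
theorem IsDatumOfRecord₁₃CCoPR.params_congr {D D' : FiniteEpsData F (SU N)} (h : IsDatumOfRecord₁₃CCoPR F N D) (h' : IsDatumOfRecord₁₃CCoPR F N D') (e : D = D') :
    h.params = h'.params := by
  subst e
  rfl

/-- **`canon₁₃CoPR f θ hP = f h.params h.provisos`** whenever `(θ, hP)` realises a datum of record `D` with key `h`. [cite: Balaban1989LargeFieldII, Thm 1 + (0.1) pp.355–356 (bookkeeping)] -/
theorem canon₁₃CoPR_eq_of_eq {f : (θ : Stage13RParams F N) → θ.Provisos₁₃CoPR F N → α} {D : FiniteEpsData F (SU N)} (h : IsDatumOfRecord₁₃CCoPR F N D)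
    (θ : Stage13RParams F N) (hP : θ.Provisos₁₃CoPR F N) (e : D = datumOfRecord₁₃CoPR F N θ hP) :
    canon₁₃CoPR F N f θ hP = f h.params h.provisos := by
  subst e
  unfold canon₁₃CoPR
  rw [dif_pos h]

/-- At the canonical parameter itself `canon₁₃CoPR f` reads `f`. [cite: Balaban1989LargeFieldII, Thm 1 + (0.1) pp.355–356 (bookkeeping)] -/
theorem canon₁₃CoPR_params {f : (θ : Stage13RParams F N) → θ.Provisos₁₃CoPR F N → α} {D : FiniteEpsData F (SU N)} (h : IsDatumOfRecord₁₃CCoPR F N D) :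
    canon₁₃CoPR F N f h.params h.provisos = f h.params h.provisos :=
  canon₁₃CoPR_eq_of_eq h h.params h.provisos h.eq_datumOfRecord₁₃CoPR

/-- At an admissible tuple with provisos, `canon₁₃CoPR f` reads `f` at the canonical parameter of ITS datum. [cite: Balaban1989LargeFieldII, Thm 1 + (0.1) pp.355–356 (bookkeeping)] -/
theorem canon₁₃CoPR_eq_of_admissible {f : (θ : Stage13RParams F N) → θ.Provisos₁₃CoPR F N → α} (θ : Stage13RParams F N) (hP : θ.Provisos₁₃CoPR F N) (hθ : θ.Admissible F N) :
    canon₁₃CoPR F N f θ hP = f (isDatumOfRecord₁₃CCoPR_datumOfRecord₁₃CoPR F N θ hP hθ).params (isDatumOfRecord₁₃CCoPR_datumOfRecord₁₃CoPR F N θ hP hθ).provisos :=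
  canon₁₃CoPR_eq_of_eq _ θ hP rfl

/-- Off the datum-of-record class nothing is canonicalised. [cite: Balaban1989LargeFieldII, Thm 1 + (0.1) pp.355–356 (bookkeeping)] -/
theorem canon₁₃CoPR_eq_self_of_not {f : (θ : Stage13RParams F N) → θ.Provisos₁₃CoPR F N → α} (θ : Stage13RParams F N) (hP : θ.Provisos₁₃CoPR F N)
    (hn : ¬ IsDatumOfRecord₁₃CCoPR F N (datumOfRecord₁₃CoPR F N θ hP)) : canon₁₃CoPR F N f θ hP = f θ hP := by
  unfold canon₁₃CoPR
  rw [dif_neg hn]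

/-- **THE KEYED-RECORD FACE**: an existentially keyed record («some admissible `θ` with provisos realises `D` and the bundle reads `canon₁₃CoPR f` there») IS the
datum-keyed record («the bundle reads `f` at the canonical parameter of `D`») — for every property `Φ` of the reading (e.g. `Φ x := S = x g₀ os`).  This is the
sentence that makes (T-SPINE)'s and (T-RATE)'s Stage-13 records COHERENT. [cite: Balaban1989LargeFieldII, Thm 1 + (0.1) pp.355–356 (bookkeeping)] -/
theorem exists_keyed_canon₁₃CoPR_iff {f : (θ : Stage13RParams F N) → θ.Provisos₁₃CoPR F N → α} {D : FiniteEpsData F (SU N)} (Φ : α → Prop) :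
    (∃ (θ : Stage13RParams F N) (hP : θ.Provisos₁₃CoPR F N), θ.Admissible F N ∧ D = datumOfRecord₁₃CoPR F N θ hP ∧ Φ (canon₁₃CoPR F N f θ hP)) ↔
      ∃ h : IsDatumOfRecord₁₃CCoPR F N D, Φ (f h.params h.provisos) := by
  constructor
  · rintro ⟨θ, hP, hθ, e, hΦ⟩
    have h : IsDatumOfRecord₁₃CCoPR F N D := ⟨θ, hP, hθ, e⟩
    refine ⟨h, ?_⟩
    rwa [canon₁₃CoPR_eq_of_eq (f := f) h θ hP e] at hΦ
  · rintro ⟨h, hΦ⟩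
    refine ⟨h.params, h.provisos, h.admissible, h.eq_datumOfRecord₁₃CoPR, ?_⟩
    rwa [canon₁₃CoPR_params (f := f) h]

/-- **COHERENCE**: two existentially keyed records read through `canon₁₃CoPR` admit, at the same datum, readings AT THE SAME PARAMETER.
[cite: Balaban1989LargeFieldII, Thm 1 + (0.1) pp.355–356 (bookkeeping)] -/
theorem keyed_canon₁₃CoPR_coherent {β : Sort*} {f : (θ : Stage13RParams F N) → θ.Provisos₁₃CoPR F N → α} {g : (θ : Stage13RParams F N) → θ.Provisos₁₃CoPR F N → β}
    {D : FiniteEpsData F (SU N)} (Φ : α → Prop) (Ψ : β → Prop)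
    (hΦ : ∃ (θ : Stage13RParams F N) (hP : θ.Provisos₁₃CoPR F N), θ.Admissible F N ∧ D = datumOfRecord₁₃CoPR F N θ hP ∧ Φ (canon₁₃CoPR F N f θ hP))
    (hΨ : ∃ (θ : Stage13RParams F N) (hP : θ.Provisos₁₃CoPR F N), θ.Admissible F N ∧ D = datumOfRecord₁₃CoPR F N θ hP ∧ Ψ (canon₁₃CoPR F N g θ hP)) :
    ∃ h : IsDatumOfRecord₁₃CCoPR F N D, Φ (f h.params h.provisos) ∧ Ψ (g h.params h.provisos) := by
  obtain ⟨h, h₁⟩ := (exists_keyed_canon₁₃CoPR_iff Φ).1 hΦ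
  obtain ⟨h', h₂⟩ := (exists_keyed_canon₁₃CoPR_iff Ψ).1 hΨ
  exact ⟨h, h₁, h₂⟩

end Canon

/-! ## §3. The θ-exposed Stage-13 record key `IsRateKey₁₃CoPR` and the residual ASSIGNMENTS of the rate-record home at Stage 13 (`RateAssignment₁₃` ∕ `SpineAssignment₁₃` over
`Stage13RParams`, with the one-token lifts `.ofStage12` ∕ `.ofStage9` of the Stage-12 ∕ Stage-9-typed assignments; RR-1's object containers BY NAME) -/

section Key

variable (F : T4Family) (N : ℕ) [NeZero N]

/-- **«(D, w) is the Stage-13 record WITH PARAMETERS θ»**: the body of `IsRecordOfRecord₁₃CCoPR F N D w` with the Stage-13 parameter tuple EXPOSED — θ is admissible and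
satisfies its displayed provisos, its datum of record IS `D`, and the world `w` is bound to the construction with a window `0 < w.γ ≤ θ.γ`, Bałaban's block size and
the C-binding of record over the Stage-13 view. [cite: Balaban1989LargeFieldII, Thm 1 + (0.1) pp.355–356; Balaban1987RG1, (0.24)–(0.25) p.257 (objects of record; bookkeeping)] -/
def IsRateKey₁₃CoPR (D : FiniteEpsData F (SU N)) (w : WorldP) (θ : Stage13RParams F N) : Prop :=
  ∃ h : θ.Provisos₁₃CoPR F N, θ.Admissible F N ∧ D = datumOfRecord₁₃CoPR F N θ h ∧ w.C = D.C ∧ (0 < w.γ ∧ w.γ ≤ θ.γ) ∧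
    w.L = (θ.L : ℝ) ∧ ∀ P : B12.RunParams, w.up P = upOfRecord₅C F N (θ.toStage5₁₃CoPR F N) P

/-- **A Stage-13 record IS a keyed record for SOME θ, and conversely** (`Iff.rfl`: the key is `IsRecordOfRecord₁₃CCoPR`'s body). [cite: Balaban1989LargeFieldII, Thm 1 + (0.1) pp.355–356 (bookkeeping)] -/
theorem isRecordOfRecord₁₃CCoPR_iff_exists_isRateKey₁₃CoPR (D : FiniteEpsData F (SU N)) (w : WorldP) :
    IsRecordOfRecord₁₃CCoPR F N D w ↔ ∃ θ : Stage13RParams F N, IsRateKey₁₃CoPR F N D w θ := Iff.rfl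

/-- **Pointed form of the key** at the datum of record. [cite: Balaban1989LargeFieldII, Thm 1 + (0.1) pp.355–356 (bookkeeping)] -/
theorem isRateKey₁₃CoPR_of_eq (θ : Stage13RParams F N) (h : θ.Provisos₁₃CoPR F N) (hθ : θ.Admissible F N) (w : WorldP)
    (hC : w.C = (datumOfRecord₁₃CoPR F N θ h).C) (hγ : 0 < w.γ ∧ w.γ ≤ θ.γ) (hL : w.L = (θ.L : ℝ))
    (hup : ∀ P, w.up P = upOfRecord₅C F N (θ.toStage5₁₃CoPR F N) P) :
    IsRateKey₁₃CoPR F N (datumOfRecord₁₃CoPR F N θ h) w θ :=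
  ⟨h, hθ, rfl, hC, hγ, hL, hup⟩

/-- **Every admissible θ satisfying its provisos is keyed at some world with any window `0 < γw ≤ θ.γ`** — inhabitation of the keyed class is Stage 13's exactly.
[cite: Balaban1989LargeFieldII, Thm 1 + (0.1) pp.355–356 (bookkeeping)] -/
theorem exists_world_isRateKey₁₃CoPR (θ : Stage13RParams F N) (h : θ.Provisos₁₃CoPR F N) (hθ : θ.Admissible F N) {γw : ℝ} (hγw : 0 < γw ∧ γw ≤ θ.γ) :
    ∃ w : WorldP, IsRateKey₁₃CoPR F N (datumOfRecord₁₃CoPR F N θ h) w θ ∧ w.γ = γw := by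
  obtain ⟨w₀⟩ := nonempty_worldP
  exact ⟨{ w₀ with
      C := (datumOfRecord₁₃CoPR F N θ h).C, γ := γw, L := (θ.L : ℝ), one_lt_L := by exact_mod_cast θ.hL.2,
      up := fun P => upOfRecord₅C F N (θ.toStage5₁₃CoPR F N) P },
    ⟨h, hθ, rfl, rfl, hγw, rfl, fun _ => rfl⟩, rfl⟩

variable {F N}
variable {D : FiniteEpsData F (SU N)} {w : WorldP} {θ : Stage13RParams F N}

/-- A keyed record is a Stage-13 record. [cite: Balaban1989LargeFieldII, Thm 1 + (0.1) pp.355–356 (bookkeeping)] -/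
theorem IsRateKey₁₃CoPR.isRecordOfRecord₁₃CCoPR (hk : IsRateKey₁₃CoPR F N D w θ) : IsRecordOfRecord₁₃CCoPR F N D w := ⟨θ, hk⟩

/-- … hence its datum is a Stage-13 datum of record. [cite: Balaban1989LargeFieldII, Thm 1 p.355 (bookkeeping)] -/
theorem IsRateKey₁₃CoPR.isDatumOfRecord₁₃CCoPR (hk : IsRateKey₁₃CoPR F N D w θ) : IsDatumOfRecord₁₃CCoPR F N D :=
  isDatumOfRecord₁₃CCoPR_of_isRecordOfRecord₁₃CCoPR hk.isRecordOfRecord₁₃CCoPR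

/-- The key CERTIFIES θ's provisos and admissibility and realises `D` as θ's datum of record. [cite: Balaban1989LargeFieldI, (0.3)–(0.4) p.176 (bookkeeping)] -/
theorem IsRateKey₁₃CoPR.exists_provisos (hk : IsRateKey₁₃CoPR F N D w θ) : ∃ h : θ.Provisos₁₃CoPR F N, θ.Admissible F N ∧ D = datumOfRecord₁₃CoPR F N θ h := by
  obtain ⟨h, hθ, hD, -⟩ := hk
  exact ⟨h, hθ, hD⟩

/-- The key's θ is admissible. [cite: Balaban1987RG1, (1.20)–(1.21) p.264 (hypothesis dictionary; bookkeeping)] -/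
theorem IsRateKey₁₃CoPR.admissible (hk : IsRateKey₁₃CoPR F N D w θ) : θ.Admissible F N := by
  obtain ⟨-, hθ, -⟩ := hk
  exact hθ

/-- The world's window is positive. [cite: Balaban1987RG1, Thm 1 p.259 (bookkeeping)] -/
theorem IsRateKey₁₃CoPR.gamma_pos (hk : IsRateKey₁₃CoPR F N D w θ) : 0 < w.γ := by
  obtain ⟨-, -, -, -, hγ, -⟩ := hk
  exact hγ.1

/-- The world's window sits inside θ's coupling window: `w.γ ≤ θ.γ`. [cite: Balaban1987RG1, Thm 1 p.259 (bookkeeping)] -/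
theorem IsRateKey₁₃CoPR.gamma_le (hk : IsRateKey₁₃CoPR F N D w θ) : w.γ ≤ θ.γ := by
  obtain ⟨-, -, -, -, hγ, -⟩ := hk
  exact hγ.2

/-- The world reads θ's block factor. [cite: Balaban1987RG1, (0.1) p.251 (bookkeeping)] -/
theorem IsRateKey₁₃CoPR.L_eq (hk : IsRateKey₁₃CoPR F N D w θ) : w.L = (θ.L : ℝ) := by
  obtain ⟨-, -, -, -, -, hL, -⟩ := hk
  exact hL

/-- The world is bound to the datum's construction. [cite: Balaban1989LargeFieldII, Thm 1 + (0.1) pp.355–356 (bookkeeping)] -/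
theorem IsRateKey₁₃CoPR.construction_eq (hk : IsRateKey₁₃CoPR F N D w θ) : w.C = D.C := by
  obtain ⟨-, -, -, hC, -⟩ := hk
  exact hC

/-- The upstream block of the world is the C-binding of record at the Stage-13 view. [cite: Balaban1989LargeFieldII, Thm 1 + (0.1) pp.355–356 (bookkeeping)] -/
theorem IsRateKey₁₃CoPR.up_eq (hk : IsRateKey₁₃CoPR F N D w θ) (P : B12.RunParams) : w.up P = upOfRecord₅C F N (θ.toStage5₁₃CoPR F N) P := by
  obtain ⟨-, -, -, -, -, -, hup⟩ := hk
  exact hup P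

end Key


/-! ## §4. «`D` is a datum of record, Stage 13, realised IN THE REGIME `Rg`» and its canonical parameter in the regime -/

section DatumKeyOn

variable (F : T4Family) (N : ℕ) [NeZero N]

/-- **«`D` is a datum of record, Stage 13, realised in the regime `Rg`»**: SOME admissible Stage-13 parameter tuple IN `Rg` satisfying its displayed provisos has `D` as its datum
of record — the common key prefix of the regime-restricted carrier homes (the Stage-13 re-keys of `YMDAG.UVSplit.RRec₁₂On 𝔯 Rg` ∕ `SRec₁₂On cr Rg`).  At `Rg := ⊤` it is the C key (`isDatumOfRecord₁₃CCoPROn_true_iff`).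
[cite: Balaban1989LargeFieldII, Thm 1 + (0.1) pp.355–356; Balaban1988Convergent, Thms 1–2 pp.262–263 (objects of record; bookkeeping)] -/
def IsDatumOfRecord₁₃CCoPROn (Rg : (F : T4Family) → Stage13RParams F N → Prop) (D : FiniteEpsData F (SU N)) : Prop :=
  ∃ (θ : Stage13RParams F N) (h : θ.Provisos₁₃CoPR F N), Rg F θ ∧ θ.Admissible F N ∧ D = datumOfRecord₁₃CoPR F N θ h

variable (Rg : (F : T4Family) → Stage13RParams F N → Prop)

/-- Unfolding (`Iff.rfl`). [cite: Balaban1989LargeFieldII, Thm 1 + (0.1) pp.355–356 (bookkeeping)] -/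
theorem isDatumOfRecord₁₃CCoPROn_iff (D : FiniteEpsData F (SU N)) :
    IsDatumOfRecord₁₃CCoPROn F N Rg D ↔ ∃ (θ : Stage13RParams F N) (h : θ.Provisos₁₃CoPR F N), Rg F θ ∧ θ.Admissible F N ∧ D = datumOfRecord₁₃CoPR F N θ h :=
  Iff.rfl

/-- Every admissible Stage-13 parameter tuple in the regime with provisos yields a datum of record in the regime. [cite: Balaban1989LargeFieldII, Thm 1 + (0.1) pp.355–356 (bookkeeping)] -/
theorem isDatumOfRecord₁₃CCoPROn_datumOfRecord₁₃CoPR (θ : Stage13RParams F N) (h : θ.Provisos₁₃CoPR F N) (hRg : Rg F θ) (hθ : θ.Admissible F N) :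
    IsDatumOfRecord₁₃CCoPROn F N Rg (datumOfRecord₁₃CoPR F N θ h) :=
  ⟨θ, h, hRg, hθ, rfl⟩

/-- **THE HONEST REDUCTION, IN THE REGIME**: some datum of record in `Rg` exists at `(F, N)` iff SOME Stage-13 parameter tuple satisfies every displayed proviso, lies in `Rg` and
is admissible; inhabitation is NOT claimed in this module. [cite: Balaban1988Convergent, (2.7) p.255, (2.21) p.258, (3.16)–(3.22) pp.268–269; Balaban1987RG1, (1.12)–(1.15) p.262 (hypothesis dictionary; bookkeeping)] -/
theorem exists_isDatumOfRecord₁₃CCoPROn_iff_exists_params :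
    (∃ D : FiniteEpsData F (SU N), IsDatumOfRecord₁₃CCoPROn F N Rg D) ↔ ∃ θ : Stage13RParams F N, θ.Provisos₁₃CoPR F N ∧ Rg F θ ∧ θ.Admissible F N := by
  constructor
  · rintro ⟨_, θ, hP, hRg, hθ, -⟩
    exact ⟨θ, hP, hRg, hθ⟩
  · rintro ⟨θ, hP, hRg, hθ⟩
    exact ⟨_, isDatumOfRecord₁₃CCoPROn_datumOfRecord₁₃CoPR F N Rg θ hP hRg hθ⟩

/-- **A PROPERTY OF EVERY DATUM OF RECORD IN THE REGIME ⟺ THE θ-KEYED SENTENCE GUARDED BY `Rg`** (datum level). [cite: Balaban1989LargeFieldII, Thm 1 + (0.1) pp.355–356 (bookkeeping)] -/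
theorem forall_isDatumOfRecord₁₃CCoPROn_iff (P : FiniteEpsData F (SU N) → Prop) :
    (∀ D : FiniteEpsData F (SU N), IsDatumOfRecord₁₃CCoPROn F N Rg D → P D) ↔
      ∀ (θ : Stage13RParams F N) (h : θ.Provisos₁₃CoPR F N), Rg F θ → θ.Admissible F N → P (datumOfRecord₁₃CoPR F N θ h) := by
  constructor
  · intro hall θ h hRg hθ
    exact hall _ (isDatumOfRecord₁₃CCoPROn_datumOfRecord₁₃CoPR F N Rg θ h hRg hθ)
  · rintro hall D ⟨θ, h, hRg, hθ, rfl⟩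
    exact hall θ h hRg hθ

variable {F N Rg}
variable {D : FiniteEpsData F (SU N)}

/-- The regime forgotten: a datum of record in `Rg` is a datum of record (C key). [cite: Balaban1989LargeFieldII, Thm 1 p.355 (bookkeeping)] -/
theorem IsDatumOfRecord₁₃CCoPROn.toC (h : IsDatumOfRecord₁₃CCoPROn F N Rg D) : IsDatumOfRecord₁₃CCoPR F N D := by
  obtain ⟨θ, hP, -, hθ, hD⟩ := h
  exact ⟨θ, hP, hθ, hD⟩

/-- Monotone in the regime. [cite: Balaban1989LargeFieldII, Thm 1 p.355 (bookkeeping)] -/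
theorem IsDatumOfRecord₁₃CCoPROn.mono {Rg' : (F : T4Family) → Stage13RParams F N → Prop} (hle : ∀ (F : T4Family) (θ : Stage13RParams F N), Rg F θ → Rg' F θ)
    (h : IsDatumOfRecord₁₃CCoPROn F N Rg D) : IsDatumOfRecord₁₃CCoPROn F N Rg' D := by
  obtain ⟨θ, hP, hRg, hθ, hD⟩ := h
  exact ⟨θ, hP, hle F θ hRg, hθ, hD⟩

/-- At the trivial regime the key IS the C key. [cite: Balaban1989LargeFieldII, Thm 1 p.355 (bookkeeping)] -/
theorem isDatumOfRecord₁₃CCoPROn_true_iff : IsDatumOfRecord₁₃CCoPROn F N (fun _ _ => True) D ↔ IsDatumOfRecord₁₃CCoPR F N D :=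
  ⟨fun h => h.toC, fun ⟨θ, hP, hθ, hD⟩ => ⟨θ, hP, trivial, hθ, hD⟩⟩

/-- A datum of record whose C-CANONICAL parameter lies in the regime is a datum of record in the regime (companion of the (T-RATE) home's `rRec₁₂On_of_regime_params`, re-keyed).
[cite: Balaban1989LargeFieldII, Thm 1 p.355 (bookkeeping)] -/
theorem IsDatumOfRecord₁₃CCoPR.isDatumOfRecord₁₃CCoPROn_of_regime_params (h : IsDatumOfRecord₁₃CCoPR F N D) (hRg : Rg F h.params) : IsDatumOfRecord₁₃CCoPROn F N Rg D :=
  ⟨h.params, h.provisos, hRg, h.admissible, h.eq_datumOfRecord₁₃CoPR⟩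

/-- **THE CANONICAL STAGE-13 PARAMETER OF A DATUM OF RECORD IN THE REGIME** (choice).  HONEST: it need not equal the C-canonical parameter `h.toC.params` of the same datum
(two choices over two existentials); the regime reaches THIS parameter (`.regime`), never `IsDatumOfRecord₁₃CCoPR.params`. [cite: Balaban1989LargeFieldII, Thm 1 + (0.1) pp.355–356 (bookkeeping)] -/
def IsDatumOfRecord₁₃CCoPROn.params (h : IsDatumOfRecord₁₃CCoPROn F N Rg D) : Stage13RParams F N :=
  Classical.choose h

/-- Its provisos. [cite: Balaban1988Convergent, (2.7) p.255, (2.21) p.258, (2.35) p.261 (bookkeeping)] -/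
theorem IsDatumOfRecord₁₃CCoPROn.provisos (h : IsDatumOfRecord₁₃CCoPROn F N Rg D) : h.params.Provisos₁₃CoPR F N :=
  (Classical.choose_spec h).fst

/-- **It lies IN THE REGIME.** [cite: Balaban1988Convergent, (3.16)–(3.22) pp.268–269 (bookkeeping)] -/
theorem IsDatumOfRecord₁₃CCoPROn.regime (h : IsDatumOfRecord₁₃CCoPROn F N Rg D) : Rg F h.params :=
  (Classical.choose_spec h).snd.1

/-- Its admissibility. [cite: Balaban1987RG1, (1.12) p.262; Balaban1988Convergent, (2.10) p.256 (bookkeeping)] -/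
theorem IsDatumOfRecord₁₃CCoPROn.admissible (h : IsDatumOfRecord₁₃CCoPROn F N Rg D) : h.params.Admissible F N :=
  (Classical.choose_spec h).snd.2.1

/-- **The datum IS the datum of record of its canonical parameter in the regime.** [cite: Balaban1989LargeFieldII, Thm 1 p.355 (bookkeeping)] -/
theorem IsDatumOfRecord₁₃CCoPROn.eq_datumOfRecord₁₃CoPR (h : IsDatumOfRecord₁₃CCoPROn F N Rg D) : D = datumOfRecord₁₃CoPR F N h.params h.provisos :=
  (Classical.choose_spec h).snd.2.2

/-- The canonical parameter realises a C-datum key of `D` (pointed form; its `.params` is NOT asserted to be `h.params`). [cite: Balaban1989LargeFieldII, Thm 1 p.355 (bookkeeping)] -/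
theorem IsDatumOfRecord₁₃CCoPROn.isDatumOfRecord₁₃CCoPR_params (h : IsDatumOfRecord₁₃CCoPROn F N Rg D) :
    IsDatumOfRecord₁₃CCoPR F N (datumOfRecord₁₃CoPR F N h.params h.provisos) :=
  isDatumOfRecord₁₃CCoPR_datumOfRecord₁₃CoPR F N h.params h.provisos h.admissible

/-- The canonical parameter's coupling window is positive. [cite: Balaban1987RG1, (0.21) p.256 (bookkeeping)] -/
theorem IsDatumOfRecord₁₃CCoPROn.gamma_pos (h : IsDatumOfRecord₁₃CCoPROn F N Rg D) : 0 < h.params.γ :=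
  h.admissible.toStage9.gamma_pos

/-- … and lies inside `]0, 1[`. [cite: Balaban1988Convergent, (2.28) p.259 (bookkeeping)] -/
theorem IsDatumOfRecord₁₃CCoPROn.gamma_lt_one (h : IsDatumOfRecord₁₃CCoPROn F N Rg D) : h.params.γ < 1 :=
  h.admissible.toStage12.pos₁₂.2.2.2.2

/-- The canonical parameter in the regime depends on the datum only. [cite: Balaban1989LargeFieldII, Thm 1 + (0.1) pp.355–356 (bookkeeping)] -/
theorem IsDatumOfRecord₁₃CCoPROn.params_congr {D' : FiniteEpsData F (SU N)} (h : IsDatumOfRecord₁₃CCoPROn F N Rg D) (h' : IsDatumOfRecord₁₃CCoPROn F N Rg D') (e : D = D') :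
    h.params = h'.params := by
  subst e
  rfl

/-- **WHAT A CONSUMER PROVES IN THE REGIME ⟹ WHAT THE INSTANCE CARRIES**: a property of the objects of record established at EVERY admissible Stage-13 parameter tuple IN `Rg` with
provisos holds at the canonical parameter in the regime of every datum of record in the regime — the regime is AVAILABLE as a hypothesis. [cite: Balaban1989LargeFieldII, Thm 1 p.355 (bookkeeping)] -/
theorem IsDatumOfRecord₁₃CCoPROn.forall_params {P : (D : FiniteEpsData F (SU N)) → (θ : Stage13RParams F N) → θ.Provisos₁₃CoPR F N → Prop}
    (hP : ∀ (θ : Stage13RParams F N) (hθ : θ.Provisos₁₃CoPR F N), Rg F θ → θ.Admissible F N → P (datumOfRecord₁₃CoPR F N θ hθ) θ hθ) (h : IsDatumOfRecord₁₃CCoPROn F N Rg D) :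
    P D h.params h.provisos := by
  have := hP h.params h.provisos h.regime h.admissible
  rwa [← h.eq_datumOfRecord₁₃CoPR] at this

/-- The datum's β-functions are the Stage-13 β of record at the canonical parameter. [cite: Balaban1987RG1, (1.20)–(1.22) p.264 (bookkeeping)] -/
theorem IsDatumOfRecord₁₃CCoPROn.βfun_eq_betaOfRecord₁₃ (h : IsDatumOfRecord₁₃CCoPROn F N Rg D) : D.βfun = betaOfRecord₁₃ F N h.params.toStage13Params := by
  have := βfun_datumOfRecord₁₃CoPR F N h.params h.provisos
  rwa [← h.eq_datumOfRecord₁₃CoPR] at this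

/-- The datum's coupling flow of the run `p` IS the Stage-13 generated history of record of the canonical parameter. [cite: Balaban1987RG1, (0.17)–(0.20) pp.255–256 (bookkeeping)] -/
theorem IsDatumOfRecord₁₃CCoPROn.flow_g (h : IsDatumOfRecord₁₃CCoPROn F N Rg D) (p : B12.RunParams) :
    (D.C p).flow.g = gOfRecord₁₃ F N h.params.toStage13Params p := by
  have := flow_g_datumOfRecord₁₃CoPR F N h.params h.provisos p
  rwa [← h.eq_datumOfRecord₁₃CoPR] at this

/-- A datum of record in the regime is a datum of record, Stage 0. [cite: Balaban1987RG1, (0.3)–(0.4) p.253 (bookkeeping)] -/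
theorem IsDatumOfRecord₁₃CCoPROn.isDatumOfRecord₀ (h : IsDatumOfRecord₁₃CCoPROn F N Rg D) : IsDatumOfRecord₀ F N D :=
  h.toC.isDatumOfRecord₀


end DatumKeyOn

/-! ## §5. «`(D, w)` is a Stage-13 record realised IN THE REGIME `Rg`»; world companions; the θ-keyed guarded junction -/

section RecordKeyOn

variable (F : T4Family) (N : ℕ) [NeZero N]

/-- **«`(D, w)` is a Stage-13 record (C-class) realised in the regime `Rg`»**: `IsRecordOfRecord₁₃CCoPR F N D w`'s body (the θ-exposed key `IsRateKey₁₃CoPR`) with the parameter IN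
`Rg` — the regime-restricted record class a guarded composer quantifies over (`Spine`, `S_R00x`, `S_N27x` at `fun F D w => IsRecordOfRecord₁₃CCoPROn F N Rg D w`).  At `Rg := ⊤` it is
`IsRecordOfRecord₁₃CCoPR` (`isRecordOfRecord₁₃CCoPROn_true_iff`). [cite: Balaban1989LargeFieldII, Thm 1 + (0.1) pp.355–356; Balaban1987RG1, (0.24)–(0.25) p.257 (objects of record; bookkeeping)] -/
def IsRecordOfRecord₁₃CCoPROn (Rg : (F : T4Family) → Stage13RParams F N → Prop) (D : FiniteEpsData F (SU N)) (w : WorldP) : Prop :=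
  ∃ θ : Stage13RParams F N, Rg F θ ∧ IsRateKey₁₃CoPR F N D w θ

variable (Rg : (F : T4Family) → Stage13RParams F N → Prop)

/-- Unfolding (`Iff.rfl`). [cite: Balaban1989LargeFieldII, Thm 1 + (0.1) pp.355–356 (bookkeeping)] -/
theorem isRecordOfRecord₁₃CCoPROn_iff (D : FiniteEpsData F (SU N)) (w : WorldP) :
    IsRecordOfRecord₁₃CCoPROn F N Rg D w ↔ ∃ θ : Stage13RParams F N, Rg F θ ∧ IsRateKey₁₃CoPR F N D w θ :=
  Iff.rfl

/-- **Every admissible θ in the regime with provisos is a record in the regime at some world with any window `0 < γw ≤ θ.γ`.** [cite: Balaban1989LargeFieldII, Thm 1 + (0.1) pp.355–356 (bookkeeping)] -/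
theorem exists_world_isRecordOfRecord₁₃CCoPROn (θ : Stage13RParams F N) (h : θ.Provisos₁₃CoPR F N) (hRg : Rg F θ) (hθ : θ.Admissible F N) {γw : ℝ}
    (hγw : 0 < γw ∧ γw ≤ θ.γ) : ∃ w : WorldP, IsRecordOfRecord₁₃CCoPROn F N Rg (datumOfRecord₁₃CoPR F N θ h) w ∧ w.γ = γw := by
  obtain ⟨w, hk, hγ⟩ := exists_world_isRateKey₁₃CoPR F N θ h hθ hγw
  exact ⟨w, ⟨θ, hRg, hk⟩, hγ⟩

/-- Some datum of record in the regime exists iff some record in the regime exists. [cite: Balaban1989LargeFieldII, Thm 1 + (0.1) pp.355–356 (bookkeeping)] -/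
theorem exists_isDatumOfRecord₁₃CCoPROn_iff_exists_record :
    (∃ D : FiniteEpsData F (SU N), IsDatumOfRecord₁₃CCoPROn F N Rg D) ↔ ∃ (D : FiniteEpsData F (SU N)) (w : WorldP), IsRecordOfRecord₁₃CCoPROn F N Rg D w := by
  constructor
  · rintro ⟨_, θ, hP, hRg, hθ, rfl⟩
    obtain ⟨w, hw, -⟩ := exists_world_isRecordOfRecord₁₃CCoPROn F N Rg θ hP hRg hθ ⟨hθ.toStage9.gamma_pos, le_rfl⟩
    exact ⟨_, w, hw⟩
  · rintro ⟨D, w, θ, hRg, hk⟩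
    obtain ⟨hP, hθ, hD⟩ := hk.exists_provisos
    exact ⟨D, θ, hP, hRg, hθ, hD⟩

/-- **A WORLD-BLIND PROPERTY AT EVERY RECORD IN THE REGIME ⟺ THE θ-KEYED SENTENCE GUARDED BY `Rg`** — the junction between a composer's conclusion over the regime-restricted
record class (e.g. `YMDAG.UVSplit.Spine` at `IsRecordOfRecord₁₃CCoPROn F N Rg`) and an item text «`∀ θ (h : θ.Provisos₁₃CoPR F N), Rg F θ → θ.Admissible F N → P (datumOfRecord₁₃CoPR F N θ h)`».
[cite: Balaban1989LargeFieldII, Thm 1 + (0.1) pp.355–356 (bookkeeping)] -/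
theorem forall_isRecordOfRecord₁₃CCoPROn_iff (P : FiniteEpsData F (SU N) → Prop) :
    (∀ (D : FiniteEpsData F (SU N)) (w : WorldP), IsRecordOfRecord₁₃CCoPROn F N Rg D w → P D) ↔
      ∀ (θ : Stage13RParams F N) (h : θ.Provisos₁₃CoPR F N), Rg F θ → θ.Admissible F N → P (datumOfRecord₁₃CoPR F N θ h) := by
  constructor
  · intro hall θ h hRg hθ
    obtain ⟨w, hw, -⟩ := exists_world_isRecordOfRecord₁₃CCoPROn F N Rg θ h hRg hθ ⟨hθ.toStage9.gamma_pos, le_rfl⟩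
    exact hall _ w hw
  · rintro hall D w ⟨θ, hRg, hk⟩
    obtain ⟨h, hθ, rfl⟩ := hk.exists_provisos
    exact hall θ h hRg hθ

variable {F N Rg}
variable {D : FiniteEpsData F (SU N)} {w : WorldP}

/-- The regime forgotten: a record in the regime is a Stage-13 record. [cite: Balaban1989LargeFieldII, Thm 1 p.355 (bookkeeping)] -/
theorem IsRecordOfRecord₁₃CCoPROn.isRecordOfRecord₁₃CCoPR (h : IsRecordOfRecord₁₃CCoPROn F N Rg D w) : IsRecordOfRecord₁₃CCoPR F N D w := by
  obtain ⟨θ, -, hk⟩ := h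
  exact hk.isRecordOfRecord₁₃CCoPR

/-- Its datum is a datum of record in the regime. [cite: Balaban1989LargeFieldII, Thm 1 p.355 (bookkeeping)] -/
theorem IsRecordOfRecord₁₃CCoPROn.isDatumOfRecord₁₃CCoPROn (h : IsRecordOfRecord₁₃CCoPROn F N Rg D w) : IsDatumOfRecord₁₃CCoPROn F N Rg D := by
  obtain ⟨θ, hRg, hk⟩ := h
  obtain ⟨hP, hθ, hD⟩ := hk.exists_provisos
  exact ⟨θ, hP, hRg, hθ, hD⟩

/-- **THE TUPLE IN THE REGIME BEHIND A RECORD IN THE REGIME** — exactly the hypothesis shape of the (T-RATE) home's `s_R00x_rRec₁₂On_of_regime` (to be re-keyed at ₁₃) («every record of `Rec` comes with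
an admissible tuple with provisos in the regime realising `D`»): ONE application. [cite: Balaban1989LargeFieldII, Thm 1 + (0.1) pp.355–356 (bookkeeping)] -/
theorem IsRecordOfRecord₁₃CCoPROn.exists_regime_tuple (h : IsRecordOfRecord₁₃CCoPROn F N Rg D w) :
    ∃ (θ : Stage13RParams F N) (hP : θ.Provisos₁₃CoPR F N), Rg F θ ∧ θ.Admissible F N ∧ D = datumOfRecord₁₃CoPR F N θ hP :=
  h.isDatumOfRecord₁₃CCoPROn

/-- Monotone in the regime. [cite: Balaban1989LargeFieldII, Thm 1 p.355 (bookkeeping)] -/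
theorem IsRecordOfRecord₁₃CCoPROn.mono {Rg' : (F : T4Family) → Stage13RParams F N → Prop} (hle : ∀ (F : T4Family) (θ : Stage13RParams F N), Rg F θ → Rg' F θ)
    (h : IsRecordOfRecord₁₃CCoPROn F N Rg D w) : IsRecordOfRecord₁₃CCoPROn F N Rg' D w := by
  obtain ⟨θ, hRg, hk⟩ := h
  exact ⟨θ, hle F θ hRg, hk⟩

/-- The world's window is positive. [cite: Balaban1987RG1, Thm 1 p.259 (bookkeeping)] -/
theorem IsRecordOfRecord₁₃CCoPROn.gamma_pos (h : IsRecordOfRecord₁₃CCoPROn F N Rg D w) : 0 < w.γ := by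
  obtain ⟨θ, -, hk⟩ := h
  exact hk.gamma_pos

/-- The world is bound to the datum's construction. [cite: Balaban1989LargeFieldII, Thm 1 + (0.1) pp.355–356 (bookkeeping)] -/
theorem IsRecordOfRecord₁₃CCoPROn.construction_eq (h : IsRecordOfRecord₁₃CCoPROn F N Rg D w) : w.C = D.C := by
  obtain ⟨θ, -, hk⟩ := h
  exact hk.construction_eq

/-- A Stage-13 record keyed at a θ IN THE REGIME is a record in the regime (pointed intro). [cite: Balaban1989LargeFieldII, Thm 1 + (0.1) pp.355–356 (bookkeeping)] -/
theorem IsRateKey₁₃CoPR.isRecordOfRecord₁₃CCoPROn {θ : Stage13RParams F N} (hk : IsRateKey₁₃CoPR F N D w θ) (hRg : Rg F θ) : IsRecordOfRecord₁₃CCoPROn F N Rg D w :=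
  ⟨θ, hRg, hk⟩

/-- At the trivial regime the record key IS `IsRecordOfRecord₁₃CCoPR`. [cite: Balaban1989LargeFieldII, Thm 1 p.355 (bookkeeping)] -/
theorem isRecordOfRecord₁₃CCoPROn_true_iff : IsRecordOfRecord₁₃CCoPROn F N (fun _ _ => True) D w ↔ IsRecordOfRecord₁₃CCoPR F N D w :=
  ⟨fun h => h.isRecordOfRecord₁₃CCoPR, fun ⟨θ, hk⟩ => ⟨θ, trivial, hk⟩⟩

/-- **DATUM OF RECORD IN THE REGIME ⟺ RECORD IN THE REGIME AT SOME WORLD.** [cite: Balaban1989LargeFieldII, Thm 1 + (0.1) pp.355–356 (bookkeeping)] -/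
theorem isDatumOfRecord₁₃CCoPROn_iff_exists_world : IsDatumOfRecord₁₃CCoPROn F N Rg D ↔ ∃ w : WorldP, IsRecordOfRecord₁₃CCoPROn F N Rg D w := by
  constructor
  · rintro ⟨θ, hP, hRg, hθ, rfl⟩
    obtain ⟨w, hw, -⟩ := exists_world_isRecordOfRecord₁₃CCoPROn F N Rg θ hP hRg hθ ⟨hθ.toStage9.gamma_pos, le_rfl⟩
    exact ⟨w, hw⟩
  · rintro ⟨w, hw⟩
    exact hw.isDatumOfRecord₁₃CCoPROn

/-- **WORLD COMPANION IN THE REGIME AT ANY WINDOW BELOW THE CANONICAL ONE** (what an N17-type home-keying binder consumes once the U3 radius is pinned in `]0, h.params.γ]`).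
[cite: Balaban1989LargeFieldII, Thm 1 + (0.1) pp.355–356 (bookkeeping)] -/
theorem IsDatumOfRecord₁₃CCoPROn.exists_world (h : IsDatumOfRecord₁₃CCoPROn F N Rg D) {γw : ℝ} (hγw : 0 < γw ∧ γw ≤ h.params.γ) :
    ∃ w : WorldP, IsRecordOfRecord₁₃CCoPROn F N Rg D w ∧ w.γ = γw := by
  obtain ⟨w, hw, hγ⟩ := exists_world_isRecordOfRecord₁₃CCoPROn F N Rg h.params h.provisos h.regime h.admissible hγw
  exact ⟨w, h.eq_datumOfRecord₁₃CoPR ▸ hw, hγ⟩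

/-- … in particular at the canonical window itself. [cite: Balaban1989LargeFieldII, Thm 1 + (0.1) pp.355–356 (bookkeeping)] -/
theorem IsDatumOfRecord₁₃CCoPROn.exists_world_gamma (h : IsDatumOfRecord₁₃CCoPROn F N Rg D) :
    ∃ w : WorldP, IsRecordOfRecord₁₃CCoPROn F N Rg D w ∧ w.γ = h.params.γ :=
  h.exists_world ⟨h.gamma_pos, le_rfl⟩

/-- The ₅C shadow at the canonical parameter in the regime (for consumers keyed at ₅C). [cite: Balaban1989LargeFieldII, Thm 1 + (0.1) pp.355–356 (bookkeeping)] -/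
theorem IsDatumOfRecord₁₃CCoPROn.exists_isRecordOfRecord₅C (h : IsDatumOfRecord₁₃CCoPROn F N Rg D) :
    ∃ (D₅ : FiniteEpsData F (SU N)) (w : WorldP), IsRecordOfRecord₅C F N D₅ w ∧ D₅.C = D.C ∧ (∀ K g₀ k, D₅.dens K g₀ k = D.dens K g₀ k) ∧
      D₅.βfun = D.βfun ∧ D₅.av = D.av :=
  h.toC.exists_isRecordOfRecord₅C

end RecordKeyOn

/-! ## §6. Canonicalised readings RELATIVE TO THE REGIME — coherence for regime homes keyed «`∃ θ hP, Rg F θ ∧ θ.Admissible F N ∧ D = datumOfRecord₁₃CoPR F N θ hP ∧ S = cr F θ hP …`»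

As `canon₁₃CoPR` (gen 2) for the C key: reading a regime-keyed record through `canon₁₃CoPROn Rg f` makes the admitted bundle a function of the DATUM, read at the canonical parameter IN
THE REGIME, so two regime homes read through `canon₁₃CoPROn Rg` admit, at the same `(F, D, g₀, os)`, bundles read at ONE parameter (`exists_keyed_canon₁₃CoPROn_iff`,
`keyed_canon₁₃CoPROn_coherent`).  Off the class `canon₁₃CoPROn Rg f = f`. -/
section CanonOn

variable (F : T4Family) (N : ℕ) [NeZero N] (Rg : (F : T4Family) → Stage13RParams F N → Prop) {α : Sort*}

/-- **CANONICALISED READING RELATIVE TO THE REGIME**: read `f` at the canonical parameter in `Rg` of the datum `datumOfRecord₁₃CoPR F N θ hP` when that datum is of record in the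
regime, else at `(θ, hP)` itself.  Kernel bookkeeping (`Classical.dec`, `dite`). [cite: Balaban1989LargeFieldII, Thm 1 + (0.1) pp.355–356 (bookkeeping)] -/
def canon₁₃CoPROn (f : (θ : Stage13RParams F N) → θ.Provisos₁₃CoPR F N → α) (θ : Stage13RParams F N) (hP : θ.Provisos₁₃CoPR F N) : α := by
  classical
  exact if h : IsDatumOfRecord₁₃CCoPROn F N Rg (datumOfRecord₁₃CoPR F N θ hP) then f h.params h.provisos else f θ hP

variable {F N Rg}

/-- **`canon₁₃CoPROn Rg f θ hP = f h.params h.provisos`** whenever `(θ, hP)` realises a datum of record in the regime `D` with key `h`. [cite: Balaban1989LargeFieldII, Thm 1 + (0.1) pp.355–356 (bookkeeping)] -/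
theorem canon₁₃CoPROn_eq_of_eq {f : (θ : Stage13RParams F N) → θ.Provisos₁₃CoPR F N → α} {D : FiniteEpsData F (SU N)} (h : IsDatumOfRecord₁₃CCoPROn F N Rg D)
    (θ : Stage13RParams F N) (hP : θ.Provisos₁₃CoPR F N) (e : D = datumOfRecord₁₃CoPR F N θ hP) :
    canon₁₃CoPROn F N Rg f θ hP = f h.params h.provisos := by
  subst e
  unfold canon₁₃CoPROn
  rw [dif_pos h]

/-- At the canonical parameter in the regime `canon₁₃CoPROn Rg f` reads `f`. [cite: Balaban1989LargeFieldII, Thm 1 + (0.1) pp.355–356 (bookkeeping)] -/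
theorem canon₁₃CoPROn_params {f : (θ : Stage13RParams F N) → θ.Provisos₁₃CoPR F N → α} {D : FiniteEpsData F (SU N)} (h : IsDatumOfRecord₁₃CCoPROn F N Rg D) :
    canon₁₃CoPROn F N Rg f h.params h.provisos = f h.params h.provisos :=
  canon₁₃CoPROn_eq_of_eq h h.params h.provisos h.eq_datumOfRecord₁₃CoPR

/-- At an admissible tuple IN THE REGIME with provisos, `canon₁₃CoPROn Rg f` reads `f` at the canonical parameter in the regime of ITS datum. [cite: Balaban1989LargeFieldII, Thm 1 + (0.1) pp.355–356 (bookkeeping)] -/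
theorem canon₁₃CoPROn_eq_of_regime {f : (θ : Stage13RParams F N) → θ.Provisos₁₃CoPR F N → α} (θ : Stage13RParams F N) (hP : θ.Provisos₁₃CoPR F N) (hRg : Rg F θ)
    (hθ : θ.Admissible F N) :
    canon₁₃CoPROn F N Rg f θ hP = f (isDatumOfRecord₁₃CCoPROn_datumOfRecord₁₃CoPR F N Rg θ hP hRg hθ).params (isDatumOfRecord₁₃CCoPROn_datumOfRecord₁₃CoPR F N Rg θ hP hRg hθ).provisos :=
  canon₁₃CoPROn_eq_of_eq _ θ hP rfl

/-- Off the class nothing is canonicalised. [cite: Balaban1989LargeFieldII, Thm 1 + (0.1) pp.355–356 (bookkeeping)] -/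
theorem canon₁₃CoPROn_eq_self_of_not {f : (θ : Stage13RParams F N) → θ.Provisos₁₃CoPR F N → α} (θ : Stage13RParams F N) (hP : θ.Provisos₁₃CoPR F N)
    (hn : ¬ IsDatumOfRecord₁₃CCoPROn F N Rg (datumOfRecord₁₃CoPR F N θ hP)) : canon₁₃CoPROn F N Rg f θ hP = f θ hP := by
  unfold canon₁₃CoPROn
  rw [dif_neg hn]

/-- **THE KEYED-RECORD FACE, IN THE REGIME**: a regime-keyed record read through `canon₁₃CoPROn Rg f` IS the datum-keyed record «the bundle reads `f` at the canonical parameter in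
the regime of `D`», for every property `Φ` of the reading. [cite: Balaban1989LargeFieldII, Thm 1 + (0.1) pp.355–356 (bookkeeping)] -/
theorem exists_keyed_canon₁₃CoPROn_iff {f : (θ : Stage13RParams F N) → θ.Provisos₁₃CoPR F N → α} {D : FiniteEpsData F (SU N)} (Φ : α → Prop) :
    (∃ (θ : Stage13RParams F N) (hP : θ.Provisos₁₃CoPR F N), Rg F θ ∧ θ.Admissible F N ∧ D = datumOfRecord₁₃CoPR F N θ hP ∧ Φ (canon₁₃CoPROn F N Rg f θ hP)) ↔
      ∃ h : IsDatumOfRecord₁₃CCoPROn F N Rg D, Φ (f h.params h.provisos) := by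
  constructor
  · rintro ⟨θ, hP, hRg, hθ, e, hΦ⟩
    have h : IsDatumOfRecord₁₃CCoPROn F N Rg D := ⟨θ, hP, hRg, hθ, e⟩
    refine ⟨h, ?_⟩
    rwa [canon₁₃CoPROn_eq_of_eq (f := f) h θ hP e] at hΦ
  · rintro ⟨h, hΦ⟩
    refine ⟨h.params, h.provisos, h.regime, h.admissible, h.eq_datumOfRecord₁₃CoPR, ?_⟩
    rwa [canon₁₃CoPROn_params (f := f) h]

/-- **COHERENCE IN THE REGIME**: two regime-keyed records read through `canon₁₃CoPROn Rg` admit, at the same datum, readings AT THE SAME PARAMETER.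
[cite: Balaban1989LargeFieldII, Thm 1 + (0.1) pp.355–356 (bookkeeping)] -/
theorem keyed_canon₁₃CoPROn_coherent {β : Sort*} {f : (θ : Stage13RParams F N) → θ.Provisos₁₃CoPR F N → α} {g : (θ : Stage13RParams F N) → θ.Provisos₁₃CoPR F N → β}
    {D : FiniteEpsData F (SU N)} (Φ : α → Prop) (Ψ : β → Prop)
    (hΦ : ∃ (θ : Stage13RParams F N) (hP : θ.Provisos₁₃CoPR F N), Rg F θ ∧ θ.Admissible F N ∧ D = datumOfRecord₁₃CoPR F N θ hP ∧ Φ (canon₁₃CoPROn F N Rg f θ hP))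
    (hΨ : ∃ (θ : Stage13RParams F N) (hP : θ.Provisos₁₃CoPR F N), Rg F θ ∧ θ.Admissible F N ∧ D = datumOfRecord₁₃CoPR F N θ hP ∧ Ψ (canon₁₃CoPROn F N Rg g θ hP)) :
    ∃ h : IsDatumOfRecord₁₃CCoPROn F N Rg D, Φ (f h.params h.provisos) ∧ Ψ (g h.params h.provisos) := by
  obtain ⟨h, h₁⟩ := (exists_keyed_canon₁₃CoPROn_iff Φ).1 hΦ
  obtain ⟨h', h₂⟩ := (exists_keyed_canon₁₃CoPROn_iff Ψ).1 hΨ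
  exact ⟨h, h₁, h₂⟩

end CanonOn

/-! ## §7. THE GUARD OF RECORD «partition of unity ∧ non-degenerate present slots» and the CN instances

The route's Stage-13 items (rev 16, to be minted) bundle `θ.ZrUnity F N` (print's partition of unity for the residual 𝐓-weights, [Balaban1988Convergent] (3.16)–(3.20)) and
`θ.SlotsNondegenerate₁₃ F N` (no present slot of record is the zero density, (3.22)) into ONE conjunction on the datum's own parameter.  Named once as a regime; the «CN key» is
§4–§6 at that regime. -/

section Guard

variable (F : T4Family) (N : ℕ) [NeZero N]

/-- **THE GUARD OF RECORD RE-ISSUED OVER THE RUN-INDEXED STRUCTURE, as a regime**: `θ.ZrUnity F N ∧ θ.SlotsNondegenerate₁₃ F N` — print's partition of unity for the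
run-indexed residual 𝐓-weights (def-T's `Stage13RParams.ZrUnity`, FILE 25 §0) AND non-degeneracy of the present slots (read through `toStage13Params`), ONE bundled
conjunction on the same `θ` (director-ym LINE №112; NOT a proviso: hypotheses a consumer takes and destructures).  The v1.2 guard `unityNondeg₁₃` of
`Node00/Record13DatumKey` is typed over `Stage13Params` with the run-blind `ZtUnity` and is NOT citable here; at the run-blind embedding it GIVES this one (§8).
[cite: Balaban1988Convergent, (3.16)–(3.20) pp.268–269, (3.22) p.269] -/
abbrev unityNondeg₁₃R : (F : T4Family) → Stage13RParams F N → Prop :=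
  fun F θ => θ.ZrUnity F N ∧ θ.SlotsNondegenerate₁₃ F N

/-- Unfolding (`Iff.rfl`). [cite: Balaban1988Convergent, (3.16)–(3.22) pp.268–269 (bookkeeping)] -/
theorem unityNondeg₁₃R_iff (θ : Stage13RParams F N) : unityNondeg₁₃R N F θ ↔ θ.ZrUnity F N ∧ θ.SlotsNondegenerate₁₃ F N :=
  Iff.rfl


/-- **THE CN KEY — «`D` is a datum of record, Stage 13, realised by an admissible tuple WITH print's partition of unity AND non-degenerate present slots»**: the datum key
at the guard of record. [cite: Balaban1989LargeFieldII, Thm 1 + (0.1) pp.355–356; Balaban1988Convergent, (3.16)–(3.22) pp.268–269 (objects of record; bookkeeping)] -/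
abbrev IsDatumOfRecord₁₃CCoPRN (D : FiniteEpsData F (SU N)) : Prop :=
  IsDatumOfRecord₁₃CCoPROn F N (unityNondeg₁₃R N) D

/-- **THE CN RECORD CLASS** at the guard of record. [cite: Balaban1989LargeFieldII, Thm 1 + (0.1) pp.355–356; Balaban1988Convergent, (3.16)–(3.22) pp.268–269 (objects of record; bookkeeping)] -/
abbrev IsRecordOfRecord₁₃CCoPRN (D : FiniteEpsData F (SU N)) (w : WorldP) : Prop :=
  IsRecordOfRecord₁₃CCoPROn F N (unityNondeg₁₃R N) D w

/-- **The CN key, literally**: SOME Stage-13 parameter tuple with provisos, `(θ.ZrUnity F N ∧ θ.SlotsNondegenerate₁₃ F N)`, admissible, has `D` as its datum of record (`Iff.rfl`).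
[cite: Balaban1989LargeFieldII, Thm 1 + (0.1) pp.355–356; Balaban1988Convergent, (3.16)–(3.22) pp.268–269 (bookkeeping)] -/
theorem isDatumOfRecord₁₃CCoPRN_iff (D : FiniteEpsData F (SU N)) :
    IsDatumOfRecord₁₃CCoPRN F N D ↔
      ∃ (θ : Stage13RParams F N) (h : θ.Provisos₁₃CoPR F N), (θ.ZrUnity F N ∧ θ.SlotsNondegenerate₁₃ F N) ∧ θ.Admissible F N ∧ D = datumOfRecord₁₃CoPR F N θ h :=
  Iff.rfl

/-- **The CN record class, literally** (`Iff.rfl`). [cite: Balaban1989LargeFieldII, Thm 1 + (0.1) pp.355–356 (bookkeeping)] -/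
theorem isRecordOfRecord₁₃CCoPRN_iff (D : FiniteEpsData F (SU N)) (w : WorldP) :
    IsRecordOfRecord₁₃CCoPRN F N D w ↔ ∃ θ : Stage13RParams F N, (θ.ZrUnity F N ∧ θ.SlotsNondegenerate₁₃ F N) ∧ IsRateKey₁₃CoPR F N D w θ :=
  Iff.rfl

/-- Intro at a guarded admissible tuple with provisos. [cite: Balaban1989LargeFieldII, Thm 1 + (0.1) pp.355–356 (bookkeeping)] -/
theorem isDatumOfRecord₁₃CCoPRN_datumOfRecord₁₃CoPR (θ : Stage13RParams F N) (h : θ.Provisos₁₃CoPR F N) (hG : θ.ZrUnity F N ∧ θ.SlotsNondegenerate₁₃ F N) (hθ : θ.Admissible F N) :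
    IsDatumOfRecord₁₃CCoPRN F N (datumOfRecord₁₃CoPR F N θ h) :=
  isDatumOfRecord₁₃CCoPROn_datumOfRecord₁₃CoPR F N _ θ h hG hθ

/-- **K0′ READS THE SAME AT THE CN DATUM**: some CN datum of record exists at `(F, N)` iff SOME Stage-13 parameter tuple satisfies every displayed proviso, print's partition of unity
and non-degeneracy of the present slots, and is admissible — the body of the route's `Record12Inhabited` (rev 15) at `(F, N)`, verbatim; inhabitation is NOT claimed here.
[cite: Balaban1988Convergent, (2.7) p.255, (2.21) p.258, (2.28) p.259, (3.16)–(3.22) pp.268–269; Balaban1987RG1, (1.12)–(1.15) p.262 (hypothesis dictionary; bookkeeping)] -/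
theorem exists_isDatumOfRecord₁₃CCoPRN_iff_exists_params :
    (∃ D : FiniteEpsData F (SU N), IsDatumOfRecord₁₃CCoPRN F N D) ↔
      ∃ θ : Stage13RParams F N, θ.Provisos₁₃CoPR F N ∧ (θ.ZrUnity F N ∧ θ.SlotsNondegenerate₁₃ F N) ∧ θ.Admissible F N :=
  exists_isDatumOfRecord₁₃CCoPROn_iff_exists_params F N _

/-- … and iff some CN record exists. [cite: Balaban1989LargeFieldII, Thm 1 + (0.1) pp.355–356 (bookkeeping)] -/
theorem exists_isRecordOfRecord₁₃CCoPRN_iff_exists_params :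
    (∃ (D : FiniteEpsData F (SU N)) (w : WorldP), IsRecordOfRecord₁₃CCoPRN F N D w) ↔
      ∃ θ : Stage13RParams F N, θ.Provisos₁₃CoPR F N ∧ (θ.ZrUnity F N ∧ θ.SlotsNondegenerate₁₃ F N) ∧ θ.Admissible F N :=
  (exists_isDatumOfRecord₁₃CCoPROn_iff_exists_record F N _).symm.trans (exists_isDatumOfRecord₁₃CCoPRN_iff_exists_params F N)

/-- **THE K2′ ∕ K3′ JUNCTION**: a world-blind property at EVERY CN record ⟺ the θ-keyed sentence «`∀ θ (h : θ.Provisos₁₃CoPR F N), (θ.ZrUnity F N ∧ θ.SlotsNondegenerate₁₃ F N) →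
θ.Admissible F N → P (datumOfRecord₁₃CoPR F N θ h)`» — the items' binder prefix (what a `Spine` ∕ endpoint composer over the CN record class reads the text off).
[cite: Balaban1989LargeFieldII, Thm 1 + (0.1) pp.355–356 (bookkeeping)] -/
theorem forall_isRecordOfRecord₁₃CCoPRN_iff (P : FiniteEpsData F (SU N) → Prop) :
    (∀ (D : FiniteEpsData F (SU N)) (w : WorldP), IsRecordOfRecord₁₃CCoPRN F N D w → P D) ↔
      ∀ (θ : Stage13RParams F N) (h : θ.Provisos₁₃CoPR F N), (θ.ZrUnity F N ∧ θ.SlotsNondegenerate₁₃ F N) → θ.Admissible F N → P (datumOfRecord₁₃CoPR F N θ h) :=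
  forall_isRecordOfRecord₁₃CCoPROn_iff F N _ P

/-- … datum-level form. [cite: Balaban1989LargeFieldII, Thm 1 + (0.1) pp.355–356 (bookkeeping)] -/
theorem forall_isDatumOfRecord₁₃CCoPRN_iff (P : FiniteEpsData F (SU N) → Prop) :
    (∀ D : FiniteEpsData F (SU N), IsDatumOfRecord₁₃CCoPRN F N D → P D) ↔
      ∀ (θ : Stage13RParams F N) (h : θ.Provisos₁₃CoPR F N), (θ.ZrUnity F N ∧ θ.SlotsNondegenerate₁₃ F N) → θ.Admissible F N → P (datumOfRecord₁₃CoPR F N θ h) :=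
  forall_isDatumOfRecord₁₃CCoPROn_iff F N _ P

/-- Every guarded admissible θ with provisos is a CN record at some world with any window `0 < γw ≤ θ.γ`. [cite: Balaban1989LargeFieldII, Thm 1 + (0.1) pp.355–356 (bookkeeping)] -/
theorem exists_world_isRecordOfRecord₁₃CCoPRN (θ : Stage13RParams F N) (h : θ.Provisos₁₃CoPR F N) (hG : θ.ZrUnity F N ∧ θ.SlotsNondegenerate₁₃ F N) (hθ : θ.Admissible F N)
    {γw : ℝ} (hγw : 0 < γw ∧ γw ≤ θ.γ) : ∃ w : WorldP, IsRecordOfRecord₁₃CCoPRN F N (datumOfRecord₁₃CoPR F N θ h) w ∧ w.γ = γw :=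
  exists_world_isRecordOfRecord₁₃CCoPROn F N _ θ h hG hθ hγw

variable {F N}
variable {D : FiniteEpsData F (SU N)} {w : WorldP}

/-- **THE GUARD AT THE CANONICAL CN PARAMETER** — the one thing the C key cannot supply. [cite: Balaban1988Convergent, (3.16)–(3.22) pp.268–269 (bookkeeping)] -/
theorem IsDatumOfRecord₁₃CCoPRN.guard (h : IsDatumOfRecord₁₃CCoPRN F N D) : h.params.ZrUnity F N ∧ h.params.SlotsNondegenerate₁₃ F N :=
  h.regime

/-- Print's partition of unity at the canonical CN parameter. [cite: Balaban1988Convergent, (3.16)–(3.20) pp.268–269 (bookkeeping)] -/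
theorem IsDatumOfRecord₁₃CCoPRN.zrUnity (h : IsDatumOfRecord₁₃CCoPRN F N D) : h.params.ZrUnity F N :=
  h.regime.1

/-- Non-degeneracy of the present slots at the canonical CN parameter. [cite: Balaban1988Convergent, (3.22) p.269 (bookkeeping)] -/
theorem IsDatumOfRecord₁₃CCoPRN.slotsNondegenerate (h : IsDatumOfRecord₁₃CCoPRN F N D) : h.params.SlotsNondegenerate₁₃ F N :=
  h.regime.2

/-- **WHAT A CONSUMER PROVES UNDER THE GUARD ⟹ WHAT THE CN INSTANCE CARRIES** (the items' binder order: guard, then admissibility). [cite: Balaban1989LargeFieldII, Thm 1 p.355 (bookkeeping)] -/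
theorem IsDatumOfRecord₁₃CCoPRN.forall_params {P : (D : FiniteEpsData F (SU N)) → (θ : Stage13RParams F N) → θ.Provisos₁₃CoPR F N → Prop}
    (hP : ∀ (θ : Stage13RParams F N) (hθ : θ.Provisos₁₃CoPR F N), (θ.ZrUnity F N ∧ θ.SlotsNondegenerate₁₃ F N) → θ.Admissible F N → P (datumOfRecord₁₃CoPR F N θ hθ) θ hθ)
    (h : IsDatumOfRecord₁₃CCoPRN F N D) : P D h.params h.provisos :=
  IsDatumOfRecord₁₃CCoPROn.forall_params hP h

/-- A CN datum is a C datum (the guard forgotten; its C-canonical parameter is NOT asserted to satisfy the guard). [cite: Balaban1989LargeFieldII, Thm 1 p.355 (bookkeeping)] -/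
theorem IsDatumOfRecord₁₃CCoPRN.isDatumOfRecord₁₃CCoPR (h : IsDatumOfRecord₁₃CCoPRN F N D) : IsDatumOfRecord₁₃CCoPR F N D :=
  h.toC

/-- A CN record is a Stage-13 record. [cite: Balaban1989LargeFieldII, Thm 1 p.355 (bookkeeping)] -/
theorem IsRecordOfRecord₁₃CCoPRN.isRecordOfRecord₁₃CCoPR' (h : IsRecordOfRecord₁₃CCoPRN F N D w) : IsRecordOfRecord₁₃CCoPR F N D w :=
  h.isRecordOfRecord₁₃CCoPR

/-- The guarded tuple behind a CN record (feeds the ₁₃ re-key of `s_R00x_rRec₁₂On_of_regime 𝔯 ·` at `unityNondeg₁₃R N` in one application). [cite: Balaban1989LargeFieldII, Thm 1 + (0.1) pp.355–356 (bookkeeping)] -/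
theorem IsRecordOfRecord₁₃CCoPRN.exists_guarded_tuple (h : IsRecordOfRecord₁₃CCoPRN F N D w) :
    ∃ (θ : Stage13RParams F N) (hP : θ.Provisos₁₃CoPR F N), (θ.ZrUnity F N ∧ θ.SlotsNondegenerate₁₃ F N) ∧ θ.Admissible F N ∧ D = datumOfRecord₁₃CoPR F N θ hP :=
  h.exists_regime_tuple

/-- A datum of record whose C-canonical parameter satisfies the guard is a CN datum. [cite: Balaban1989LargeFieldII, Thm 1 p.355 (bookkeeping)] -/
theorem IsDatumOfRecord₁₃CCoPR.isDatumOfRecord₁₃CCoPRN_of_guard (h : IsDatumOfRecord₁₃CCoPR F N D) (hG : h.params.ZrUnity F N ∧ h.params.SlotsNondegenerate₁₃ F N) :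
    IsDatumOfRecord₁₃CCoPRN F N D :=
  h.isDatumOfRecord₁₃CCoPROn_of_regime_params hG

end Guard

/-! ## §8. THE RUN-BLIND DOORS `…CoP → …CoPR` along def-T's `Stage13RParams.ofRunBlind` (ONE-WAY; the datum-level half of «K0 (v1.6) ⇐ K0 (v1.5)»)

Every v1.5 `CoP`-keyed class instance IS a v1.6 `CoPR`-keyed one AT THE SAME DATUM (and world), the parameter being def-T's run-blind embedding
`Stage13RParams.ofRunBlind F N θ := ⟨θ, fun p => θ.Zt p.K⟩` (`Node00/Record13CoPR` §R1: `Stage13Params.Provisos₁₃Core.ofRunBlind`, `datumOfRecord₁₃CoPR_ofRunBlind` (`rfl`),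
`Stage13RParams.admissible_ofRunBlind_iff ∕ slotsNondegenerate₁₃_ofRunBlind_iff` (`Iff.rfl`), `Stage12Params.ZtUnity.ofRunBlind`, `Stage13RParams.toStage5₁₃CoPR_ofRunBlind`).
NO CONVERSE: a run-indexed residual need not be run-blind (FINDING №8) — nothing `CoPR → CoP` is statable as an implication of classes and none is filed. -/

section RunBlindDoors

variable {F : T4Family} {N : ℕ} [NeZero N]
variable {D : FiniteEpsData F (SU N)} {w : WorldP}

/-- **EVERY v1.5 DATUM OF RECORD IS A v1.6 DATUM OF RECORD** (same datum; parameter `Stage13RParams.ofRunBlind F N h.params`).  One-way.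
[cite: Balaban1989LargeFieldII, Thm 1 + (0.1) pp.355–356; Balaban1988Convergent, (3.16) p.268 (bookkeeping)] -/
theorem IsDatumOfRecord₁₃CCoPR.ofCoP (h : IsDatumOfRecord₁₃CCoP F N D) : IsDatumOfRecord₁₃CCoPR F N D := by
  obtain ⟨θ, hP, hθ, hD⟩ := h
  exact ⟨Stage13RParams.ofRunBlind F N θ, hP.ofRunBlind, hθ, hD.trans (datumOfRecord₁₃CoPR_ofRunBlind hP).symm⟩

/-- **EVERY v1.5 KEYED RECORD IS A v1.6 KEYED RECORD at the run-blind embedding of its parameter** (same datum, same world; the Stage-5 view by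
`Stage13RParams.toStage5₁₃CoPR_ofRunBlind`).  One-way. [cite: Balaban1989LargeFieldII, Thm 1 + (0.1) pp.355–356 (bookkeeping)] -/
theorem IsRateKey₁₃CoPR.ofCoP {θ : Stage13Params F N} (hk : IsRateKey₁₃CoP F N D w θ) : IsRateKey₁₃CoPR F N D w (Stage13RParams.ofRunBlind F N θ) := by
  obtain ⟨hP, hθ, hD, hC, hγ, hL, hup⟩ := hk
  exact ⟨hP.ofRunBlind, hθ, hD.trans (datumOfRecord₁₃CoPR_ofRunBlind hP).symm, hC, hγ, hL,
    fun P => (hup P).trans (congrArg (fun ϑ => upOfRecord₅C F N ϑ P) (Stage13RParams.toStage5₁₃CoPR_ofRunBlind F N θ).symm)⟩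

/-- **REGIME FORM, DATUM**: a v1.5 datum of record IN a regime `Rg` is a v1.6 datum of record in any regime `RgR` the run-blind embedding carries `Rg` into.  One-way.
[cite: Balaban1989LargeFieldII, Thm 1 + (0.1) pp.355–356 (bookkeeping)] -/
theorem IsDatumOfRecord₁₃CCoPROn.ofCoP {Rg : (F : T4Family) → Stage13Params F N → Prop} {RgR : (F : T4Family) → Stage13RParams F N → Prop}
    (hRg : ∀ (F : T4Family) (θ : Stage13Params F N), Rg F θ → RgR F (Stage13RParams.ofRunBlind F N θ)) (h : IsDatumOfRecord₁₃CCoPOn F N Rg D) :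
    IsDatumOfRecord₁₃CCoPROn F N RgR D := by
  obtain ⟨θ, hP, hr, hθ, hD⟩ := h
  exact ⟨Stage13RParams.ofRunBlind F N θ, hP.ofRunBlind, hRg F θ hr, hθ, hD.trans (datumOfRecord₁₃CoPR_ofRunBlind hP).symm⟩

/-- **REGIME FORM, RECORD**: a v1.5 record IN a regime `Rg` is a v1.6 record in any regime `RgR` the run-blind embedding carries `Rg` into.  One-way.
[cite: Balaban1989LargeFieldII, Thm 1 + (0.1) pp.355–356 (bookkeeping)] -/
theorem IsRecordOfRecord₁₃CCoPROn.ofCoP {Rg : (F : T4Family) → Stage13Params F N → Prop} {RgR : (F : T4Family) → Stage13RParams F N → Prop}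
    (hRg : ∀ (F : T4Family) (θ : Stage13Params F N), Rg F θ → RgR F (Stage13RParams.ofRunBlind F N θ)) (h : IsRecordOfRecord₁₃CCoPOn F N Rg D w) :
    IsRecordOfRecord₁₃CCoPROn F N RgR D w := by
  obtain ⟨θ, hr, hk⟩ := h
  exact ⟨Stage13RParams.ofRunBlind F N θ, hRg F θ hr, IsRateKey₁₃CoPR.ofCoP hk⟩

/-- **CN FORM, DATUM**: a v1.5 CN datum of record (guard `unityNondeg₁₃ N`: `ZtUnity ∧ SlotsNondegenerate₁₃`) is a v1.6 CN datum of record (guard `unityNondeg₁₃R N`), the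
partition of unity transported by def-T's `Stage12Params.ZtUnity.ofRunBlind`, slot non-degeneracy by `Iff.rfl`.  One-way.
[cite: Balaban1988Convergent, (3.16)–(3.22) pp.268–269; Balaban1989LargeFieldII, Thm 1 p.355 (bookkeeping)] -/
theorem IsDatumOfRecord₁₃CCoPRN.ofCoP (h : IsDatumOfRecord₁₃CCoPN F N D) : IsDatumOfRecord₁₃CCoPRN F N D :=
  IsDatumOfRecord₁₃CCoPROn.ofCoP (fun _ _ hG => ⟨hG.1.ofRunBlind, hG.2⟩) h

/-- **CN FORM, RECORD**: a v1.5 CN record is a v1.6 CN record (same datum, same world).  One-way.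
[cite: Balaban1988Convergent, (3.16)–(3.22) pp.268–269; Balaban1989LargeFieldII, Thm 1 p.355 (bookkeeping)] -/
theorem IsRecordOfRecord₁₃CCoPRN.ofCoP (h : IsRecordOfRecord₁₃CCoPN F N D w) : IsRecordOfRecord₁₃CCoPRN F N D w :=
  IsRecordOfRecord₁₃CCoPROn.ofCoP (fun _ _ hG => ⟨hG.1.ofRunBlind, hG.2⟩) h

end RunBlindDoors

end Literature.MathematicalPhysics.QuantumFieldTheory.Balaban1983to89.Node00

end
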